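import Literature.AlgebraicGeometry.Motives.CompleteIntersectionChowGroups
import Literature.AlgebraicGeometry.Motives.FanoSchemeOfLinesPoints
import Literature.AlgebraicGeometry.Motives.FanoSchemeOfPlanes
import Literature.AlgebraicGeometry.Motives.LinesGenerateChowOneProofs
import Literature.AlgebraicGeometry.Motives.VarietiesProjectiveSpaceProofs
import Literature.RingTheory.KrullDimension.HomogeneousCommonZero
import Mathlib.LinearAlgebra.LinearIndependent.Lemmas
import Mathlib.Data.Sym.Card
import Mathlib.Data.Finsupp.Fin
import HarnessLib

/-!
# Towards Esnault–Levine–Viehweg 1997: lines through every point of `V₊(F₁, …, F_r)` (Lemma 1.1, `s = 0`)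

Helper results for the named fact
`Literature.AlgebraicGeometry.Motives.EsnaultLevineViehweg1997_chowGroup_rank_le_one`
(`Motives/CompleteIntersectionChowGroups`), following the printed proof of H. Esnault, M. Levine,
E. Viehweg, *Chow groups of projective varieties of very small degree*, Duke Math. J. **87** (1997)
29–58 [EsnaultLevineViehweg1997] (text read: `paper:doi-10-1215-s0012-7094-97-08702-0`, §1 and §4).

The first geometric input of that proof (§1, Lemma 1.1, the case `s = 0`; used in the proof of
Lemma 4.2 a): "for each `v` and for each point `x ∈ X_v` there exists an `l`-plane `H ∈ Gr_k(l; X_v)`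
which contains `x`") is the statement that the lines on a hypersurface `X = V₊(f) ⊆ ℙⁿ` of degree
`d` passing through a given point of `X` form a subscheme of `ℙⁿ⁻¹` cut out by `C(d, 1) = d`
equations, hence a non-empty one as soon as `d ≤ n - 1`; for `X = V₊(F₁, …, F_r)` the equations add
up, and **through every point of `V₊(F₁, …, F_r) ⊆ ℙⁿ_k` (`k` algebraically closed) there passes a
line contained in `V₊(F₁, …, F_r)` as soon as `Σᵢ deg Fᵢ ≤ n - 1`**
(`exists_linearIndependent_lineRestrict_eq_zero`, `exists_mem_linesOn_of_sum_degree_le`).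

Proof (ELV, proof of Lemma 1.1, in coordinates): expand `F(s p + t y) = Σⱼ Φⱼ(y) s^{d-j} tʲ` in
`k[y₀, …, yₙ][s, t]`; the `Φⱼ`, `1 ≤ j ≤ d`, are polynomials in `y` without constant term (because
`F(s p) = s^d F(p) = 0`), and `Φ₀(v) = F(p) = 0` for every `v`; together with one coordinate function
`y_{m}` (where `p_m ≠ 0`, to force `v ∉ k p`) this gives `≤ Σᵢ dᵢ + 1 < n + 1` polynomials without
constant term in `n + 1` variables, which have a common zero `v ≠ 0` by the projective dimension
theorem (Krull's height theorem; `Literature.RingTheory.KrullDimension.exists_ne_zero_common_zero_of_card_lt`,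
Shatz IV §3 / Hartshorne I Thm. 7.2). Then every coefficient of `Fᵢ(s p + t v) ∈ k[s, t]` vanishes,
i.e. `FanoScheme.lineRestrict p v (F i) = 0`: the line `ℙ(span(p, v))` lies on `V₊(F)`
(`FanoScheme.linesOn`, `Motives/FanoSchemeOfLinesPoints`).

Second (§4, p. 15 of the preprint text: "It is immediate that a weakly rationally connected `Y` has
`A₀(Y) = 0`", and the last sentence of the proof of Thm. 4.6: "all the `l`-planes in `X_v` have the
same class in `CH_l(X_v)_ℚ`"), the ALGEBRAIC half of the passage from subvarieties to the rank
statement of the named fact: on a compact scheme `CH_d` is generated by the classes of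
`d`-dimensional points (`ChowGroup.eq_top_of_forall_ofPoint_mem`, `Motives/LinesGenerateChowOneProofs`),
so **`CH_d(Y)` has `ℚ`-rank `≤ 1` (any two classes are `ℤ`-dependent) as soon as any two classes of
`d`-dimensional subvarieties are `ℤ`-dependent** (`chowGroup_exists_smul_eq_smul_of_forall_ofPoint`,
from the group-theoretic `exists_smul_eq_smul_of_closure_eq_top`; for smooth projective `X`:
`chowGroup_exists_smul_eq_smul_of_isSmoothProjective`), and more precisely the **skeleton of the
proof of Thm. 4.6** (`chowGroup_exists_smul_eq_smul_of_inputs`): rank `≤ 1` follows from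
(a) generation up to non-zero multiples of every prime `d`-cycle by prime cycles of "planes"
(ELV §3 + `CH_{t+l}(ℙⁿ) = ℤ`) and (b) `ℤ`-dependence of any two "plane" classes (ELV Prop. 4.4),
for an arbitrary property `P` of `d`-dimensional points standing for "is an `l`-plane of `X_v`";
and, for `l' = 0`, the skeleton of "a weakly rationally connected `Y` has `A₀(Y)_ℚ = 0`" (ELV p. 15):
rank `≤ 1` of `CH₀` from positive proportionality of points on a common rational curve and chain
connectedness (`chowGroup_zero_exists_smul_eq_smul_of_reflTransGen`).
The GEOMETRIC inputs themselves (points joined by a line, or `l`-planes in a connected family, have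
dependent classes; chain connectedness by lines; Roitman's ruled cycles) are not here.

Third, **Lemma 1.1 for general `s` and Lemma 4.2 a): `l`-planes through every point.** With the
plane restriction `FanoPlanes.planeRestrict p g = g(Σ σ_a p_a)` of `Motives/FanoSchemeOfPlanes`
(`p₀, …, p_s` spanning an `s`-plane): if every `Fᵢ` vanishes identically on the `s`-plane of `p` and
`Σᵢ C(dᵢ + s, s + 1) ≤ n - s - 1`, there is `v` with `v, p₀, …, p_s` independent and every `Fᵢ`
vanishing identically on their `(s+1)`-plane (`exists_planeRestrict_cons_eq_zero` — ELV Lemma 1.1: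
the fibres of `π'₁` are cut out by `C(s+d, s+1)` equations in `ℙ^{n-s-1}`; the count is stars and
bars, Mathlib `Sym.card_sym_eq_choose`, on the coefficients of positive `τ`-degree of
`Fᵢ(τ y + Σ σ_a p_a)`, whose `τ`-free part is `Fᵢ(Σ σ_a p_a) = 0` via Mathlib `finSuccEquiv`);
by induction on `l` (**Lemma 4.2 a)**), through every point of `V₊(F₁, …, F_r)` passes an `l`-plane
of `V₊(F₁, …, F_r)` as soon as `Σᵢ C(dᵢ + s, s + 1) ≤ n - s - 1` for all `s < l`
(`exists_plane_through_point`), in particular when `Σᵢ C(dᵢ + l - 1, l) ≤ n - l` (ELV (14),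
non-strict: `exists_plane_through_point_of_le`), in particular under the printed hypothesis (13)
`Σᵢ C(dᵢ + l, l + 1) ≤ n` with `dᵢ ≥ 2` and (`some dᵢ ≥ 3` or `r ≥ l`)
(`sum_choose_le_of_hypothesis13`, `exists_plane_through_point_of_hypothesis13`; the strict propagation to all
`s < l` is **Lemma 4.5**: `sum_choose_lt_of_hypothesis13`, and the all-quadrics bullet
`sum_choose_lt_of_quadrics`, `exists_plane_through_point_of_quadrics`). The strong-plane half of Lemma 1.1 for
general `s` (incidence `H`: "`π₁` is surjective if `C(s+d, s+1) ≤ n - s`", Roitman's construction):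
with `Σᵢ (C(dᵢ + s, s + 1) - 1) ≤ n - s - 1` there is `v` with `Fᵢ(τ v + Σ σ_a p_a) = Fᵢ(v) τ^{dᵢ}`
for all `i` (`exists_planeRestrict_cons_eq_C_mul_X_pow`; the `(s+1)`-plane then meets each `V₊(Fᵢ)`
in the old `s`-plane only, or lies on it: `eq_zero_of_aeval_eq_zero_of_planeRestrict_cons_eq`).
Not here: part b) of Lemma 4.2 (irreducibility of `Gr(l; X_v)` for general `v`, char `0`) and
Lemma 4.1 (smoothness / codimension / anticanonical class of `Gr(l; X_v)`).

## References

* [EsnaultLevineViehweg1997] H. Esnault, M. Levine, E. Viehweg, Duke Math. J. 87 (1997) 29–58: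
  §1 Lemma 1.1 (fibres of `π'₁` are cut out by `C(s+d, s+1)` equations in `ℙ^{n-s-1}`, surjective if
  `≤ n - s - 1`), proof of Lemma 4.2 a).
* [Shatz1972] S. S. Shatz, *Profinite groups, arithmetic, and geometry*, Ch. IV §3 (intersection
  dimension theorem), as vendored in `Literature/RingTheory/KrullDimension/HomogeneousCommonZero`.
-/

noncomputable section

open MvPolynomial AlgebraicGeometry

universe u

namespace Literature.AlgebraicGeometry.Motives

namespace EsnaultLevineViehweg

section TaylorAlongLine

variable {k : Type u} [Field k] {n : ℕ} (p : Fin (n + 1) → k)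

-- The *universal restriction* `g ↦ g(s p + t y) ∈ k[y₀, …, yₙ][s, t]` of forms to the lines
-- through the fixed vector `p` (`y` = the variables of the outer polynomial ring, `s = X 0`,
-- `t = X 1`) is written out in full below as
-- `aeval (fun i => C (C (p i)) * X 0 + C (X i) * X 1) g` (no abbreviation, to keep this file
-- definition-free).

/-- Specialising the universal restriction `g(s p + t y)` at `y = v` gives the restriction
`g(s p + t v)` of `g` to the line through `p` and `v` (`FanoScheme.lineRestrict`). [folklore] -/
theorem map_eval_lineRestrictUniv (g : MvPolynomial (Fin (n + 1)) k) (v : Fin (n + 1) → k) :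
    MvPolynomial.map (eval v) (MvPolynomial.aeval (fun i : Fin (n + 1) =>
      (C (C (p i)) * X 0 + C (X i) * X 1 : MvPolynomial (Fin 2) (MvPolynomial (Fin (n + 1)) k))) g) = FanoScheme.lineRestrict p v g := by
  have key : (MvPolynomial.map (eval v)).comp (MvPolynomial.aeval (R := k) (fun i : Fin (n + 1) =>
        (C (C (p i)) * X 0 + C (X i) * X 1 :
          MvPolynomial (Fin 2) (MvPolynomial (Fin (n + 1)) k)))).toRingHom =
      (aeval (fun i : Fin (n + 1) => (C (p i) * X 0 + C (v i) * X 1 : MvPolynomial (Fin 2) k)) :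
        MvPolynomial (Fin (n + 1)) k →ₐ[k] MvPolynomial (Fin 2) k).toRingHom := by
    apply MvPolynomial.ringHom_ext
    · intro c
      simp only [RingHom.coe_comp, AlgHom.toRingHom_eq_coe, RingHom.coe_coe, Function.comp_apply,
        aeval_C, MvPolynomial.algebraMap_apply, MvPolynomial.algebraMap_eq, map_C, eval_C]
    · intro i
      simp only [RingHom.coe_comp, AlgHom.toRingHom_eq_coe, RingHom.coe_coe, Function.comp_apply,
        aeval_X, map_add, map_mul, map_C, map_X, eval_C, eval_X]
  exact RingHom.congr_fun key g

/-- The coefficients of `g(s p + t v) ∈ k[s, t]` are the values at `v` of the coefficients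
`Φ ∈ k[y]` of the universal restriction `g(s p + t y)`. [folklore] -/
theorem coeff_lineRestrict_eq_eval (g : MvPolynomial (Fin (n + 1)) k) (v : Fin (n + 1) → k)
    (e : Fin 2 →₀ ℕ) :
    coeff e (FanoScheme.lineRestrict p v g) = eval v (coeff e (MvPolynomial.aeval (fun i : Fin (n + 1) =>
      (C (C (p i)) * X 0 + C (X i) * X 1 : MvPolynomial (Fin 2) (MvPolynomial (Fin (n + 1)) k))) g)) := by
  rw [← map_eval_lineRestrictUniv p g v, coeff_map]

/-- The universal restriction of a form of degree `d` is a form of degree `d` in `s, t`.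
[folklore] -/
theorem isHomogeneous_lineRestrictUniv {g : MvPolynomial (Fin (n + 1)) k} {d : ℕ}
    (hg : g.IsHomogeneous d) : (MvPolynomial.aeval (fun i : Fin (n + 1) =>
      (C (C (p i)) * X 0 + C (X i) * X 1 : MvPolynomial (Fin 2) (MvPolynomial (Fin (n + 1)) k))) g).IsHomogeneous d := by
  have h := hg.aeval (fun i : Fin (n + 1) =>
    (C (C (p i)) * X 0 + C (X i) * X 1 : MvPolynomial (Fin 2) (MvPolynomial (Fin (n + 1)) k)))
    (n := 1) (fun i => (isHomogeneous_C_mul_X _ _).add (isHomogeneous_C_mul_X _ _))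
  rwa [one_mul] at h

/-- The restriction `g(s p + t v)` of a form of degree `d` is a form of degree `d` in `s, t`.
[folklore] -/
theorem isHomogeneous_lineRestrict {g : MvPolynomial (Fin (n + 1)) k} {d : ℕ}
    (hg : g.IsHomogeneous d) (v : Fin (n + 1) → k) :
    (FanoScheme.lineRestrict p v g).IsHomogeneous d := by
  have h := hg.aeval (fun i : Fin (n + 1) => (C (p i) * X 0 + C (v i) * X 1 : MvPolynomial (Fin 2) k))
    (n := 1) (fun i => (isHomogeneous_C_mul_X _ _).add (isHomogeneous_C_mul_X _ _))
  rwa [one_mul] at h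

/-- Evaluating at constants: `g(C p₀, …, C pₙ) = C (g(p))`. [folklore] -/
theorem aeval_C_comp (g : MvPolynomial (Fin (n + 1)) k) {R : Type*} [CommSemiring R] [Algebra k R]
    (q : Fin (n + 1) → k) :
    aeval (fun i => algebraMap k R (q i)) g = algebraMap k R (aeval q g) := by
  have key : (aeval fun i => algebraMap k R (q i)) = (Algebra.ofId k R).comp (aeval q) := by
    apply MvPolynomial.algHom_ext
    intro i
    simp
  rw [key]
  rfl

/-- `g(s p) = s^d · g(p)` in `k[y][s, t]` for a form `g` of degree `d` (Euler's scaling identity):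
the universal restriction with `y` specialised to `0`. [folklore] -/
theorem map_constantCoeff_lineRestrictUniv {g : MvPolynomial (Fin (n + 1)) k} {d : ℕ}
    (hg : g.IsHomogeneous d) :
    MvPolynomial.map (constantCoeff : MvPolynomial (Fin (n + 1)) k →+* k) (MvPolynomial.aeval (fun i : Fin (n + 1) =>
      (C (C (p i)) * X 0 + C (X i) * X 1 : MvPolynomial (Fin 2) (MvPolynomial (Fin (n + 1)) k))) g) =
      X 0 ^ d * C (eval p g) := by
  have h1 : MvPolynomial.map (constantCoeff : MvPolynomial (Fin (n + 1)) k →+* k) (MvPolynomial.aeval (fun i : Fin (n + 1) =>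
      (C (C (p i)) * X 0 + C (X i) * X 1 : MvPolynomial (Fin 2) (MvPolynomial (Fin (n + 1)) k))) g) =
      FanoScheme.lineRestrict p (0 : Fin (n + 1) → k) g := by
    rw [← map_eval_lineRestrictUniv p g 0, MvPolynomial.eval_zero]
  rw [h1]
  have h2 : FanoScheme.lineRestrict p (0 : Fin (n + 1) → k) g =
      aeval (fun i : Fin (n + 1) => (X 0 * C (p i) : MvPolynomial (Fin 2) k)) g := by
    unfold FanoScheme.lineRestrict
    rw [show (fun i : Fin (n + 1) => (C (p i) * X 0 + C ((0 : Fin (n + 1) → k) i) * X 1 :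
        MvPolynomial (Fin 2) k)) = fun i => X 0 * C (p i) from funext fun i => by simp [mul_comm]]
  rw [h2, ProjectiveSpace.isHomogeneous_aeval_const_mul hg (X 0) (fun i => C (p i))]
  congr 1
  have h3 := aeval_C_comp g (R := MvPolynomial (Fin 2) k) p
  simpa only [algebraMap_eq, MvPolynomial.aeval_eq_eval] using h3

/-- If `g(p) = 0` for a form `g`, every coefficient `Φ ∈ k[y]` of the universal restriction
`g(s p + t y)` is a polynomial without constant term (`Φ(0)` is a coefficient of
`g(s p) = s^d g(p) = 0`). [cite: EsnaultLevineViehweg1997, proof of Lemma 1.1] -/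
theorem constantCoeff_coeff_lineRestrictUniv {g : MvPolynomial (Fin (n + 1)) k} {d : ℕ}
    (hg : g.IsHomogeneous d) (hgp : eval p g = 0) (e : Fin 2 →₀ ℕ) :
    constantCoeff (coeff e (MvPolynomial.aeval (fun i : Fin (n + 1) =>
      (C (C (p i)) * X 0 + C (X i) * X 1 : MvPolynomial (Fin 2) (MvPolynomial (Fin (n + 1)) k))) g)) = 0 := by
  have h := congr_arg (coeff e) (map_constantCoeff_lineRestrictUniv p hg)
  rw [coeff_map, hgp, C_0, mul_zero, coeff_zero] at h
  exact h

/-- For a binary form `G(s, t)` of degree `d`, `G(1, 0)` is the coefficient of `s^d`. [folklore] -/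
theorem eval_one_zero_eq_coeff {K : Type*} [CommSemiring K] {G : MvPolynomial (Fin 2) K} {d : ℕ}
    (hG : G.IsHomogeneous d) : eval ![1, 0] G = coeff (Finsupp.single 0 d) G := by
  classical
  rw [eval_eq']
  have hterm : ∀ e ∈ G.support, e ≠ Finsupp.single 0 d →
      coeff e G * ∏ i : Fin 2, (![(1 : K), 0] i) ^ e i = 0 := by
    intro e he hne
    have hdeg : e.degree = d := by
      by_contra h
      exact (mem_support_iff.mp he) (hG.coeff_eq_zero h)
    have hsum : e 0 + e 1 = d := by
      rw [Finsupp.degree_eq_sum, Fin.sum_univ_two] at hdeg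
      exact hdeg
    have he1 : e 1 ≠ 0 := by
      intro h0
      apply hne
      ext i
      fin_cases i
      · simp only [Fin.zero_eta, Fin.isValue, Finsupp.single_eq_same]
        omega
      · simp [h0]
    rw [Fin.prod_univ_two]
    simp [zero_pow he1]
  rw [Finset.sum_eq_single (Finsupp.single 0 d) hterm]
  · simp [Fin.prod_univ_two]
  · intro hnot
    rw [notMem_support_iff.mp hnot, zero_mul]

/-- The coefficient of `s^d` in `g(s p + t v)` is `g(p)`: it is the value at `(s, t) = (1, 0)`.
[folklore] -/
theorem coeff_single_zero_lineRestrict {g : MvPolynomial (Fin (n + 1)) k} {d : ℕ}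
    (hg : g.IsHomogeneous d) (v : Fin (n + 1) → k) :
    coeff (Finsupp.single 0 d) (FanoScheme.lineRestrict p v g) = eval p g := by
  rw [← eval_one_zero_eq_coeff (isHomogeneous_lineRestrict p hg v), FanoScheme.eval_lineRestrict]
  simp

/-- **Vanishing criterion.** For a form `g` of degree `d` with `g(p) = 0`, the restriction
`g(s p + t v)` vanishes identically as soon as the coefficients `Φⱼ` of `s^{d-j} tʲ`, `1 ≤ j ≤ d`,
of the universal restriction vanish at `v` (the coefficient of `s^d` is `g(p) = 0`, and all other
coefficients vanish by homogeneity). [cite: EsnaultLevineViehweg1997, proof of Lemma 1.1] -/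
theorem lineRestrict_eq_zero_of_eval_coeff_eq_zero {g : MvPolynomial (Fin (n + 1)) k} {d : ℕ}
    (hg : g.IsHomogeneous d) (hgp : eval p g = 0) {v : Fin (n + 1) → k}
    (hv : ∀ j, 1 ≤ j → j ≤ d →
      eval v (coeff (Finsupp.single 0 (d - j) + Finsupp.single 1 j) (MvPolynomial.aeval (fun i : Fin (n + 1) =>
      (C (C (p i)) * X 0 + C (X i) * X 1 : MvPolynomial (Fin 2) (MvPolynomial (Fin (n + 1)) k))) g)) = 0) :
    FanoScheme.lineRestrict p v g = 0 := by
  classical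
  ext e
  rw [coeff_zero]
  by_cases hdeg : e.degree = d
  · -- `e = (d - j, j)` with `j = e 1`
    have he : e = Finsupp.single 0 (d - e 1) + Finsupp.single 1 (e 1) := by
      have hsum : e 0 + e 1 = d := by
        rw [Finsupp.degree_eq_sum, Fin.sum_univ_two] at hdeg
        exact hdeg
      ext i
      fin_cases i
      · simp only [Fin.zero_eta, Fin.isValue, Finsupp.coe_add, Pi.add_apply,
          Finsupp.single_eq_same, Finsupp.single_apply]
        simp only [Fin.isValue, one_ne_zero, ↓reduceIte, add_zero]
        omega
      · simp
    by_cases h1 : e 1 = 0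
    · -- the coefficient of `s^d` is `g(p) = 0`
      have he' : e = Finsupp.single 0 d := by
        rw [he, h1, Nat.sub_zero, Finsupp.single_zero, add_zero]
      rw [he', coeff_single_zero_lineRestrict p hg v, hgp]
    · have hle : e 1 ≤ d := by
        rw [Finsupp.degree_eq_sum, Fin.sum_univ_two] at hdeg
        omega
      rw [coeff_lineRestrict_eq_eval, he]
      exact hv (e 1) (Nat.one_le_iff_ne_zero.mpr h1) hle
  · exact (isHomogeneous_lineRestrict p hg v).coeff_eq_zero hdeg

/-- For a binary form `G(s, t)` of degree `d`, `G(0, 1)` is the coefficient of `t^d`. [folklore] -/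
theorem eval_zero_one_eq_coeff {K : Type*} [CommSemiring K] {G : MvPolynomial (Fin 2) K} {d : ℕ}
    (hG : G.IsHomogeneous d) : eval ![0, 1] G = coeff (Finsupp.single 1 d) G := by
  classical
  rw [eval_eq']
  have hterm : ∀ e ∈ G.support, e ≠ Finsupp.single 1 d →
      coeff e G * ∏ i : Fin 2, (![(0 : K), 1] i) ^ e i = 0 := by
    intro e he hne
    have hdeg : e.degree = d := by
      by_contra h
      exact (mem_support_iff.mp he) (hG.coeff_eq_zero h)
    have hsum : e 0 + e 1 = d := by
      rw [Finsupp.degree_eq_sum, Fin.sum_univ_two] at hdeg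
      exact hdeg
    have he0 : e 0 ≠ 0 := by
      intro h0
      apply hne
      ext i
      fin_cases i
      · simp [h0]
      · simp only [Fin.mk_one, Fin.isValue, Finsupp.single_eq_same]
        omega
    rw [Fin.prod_univ_two]
    simp [zero_pow he0]
  rw [Finset.sum_eq_single (Finsupp.single 1 d) hterm]
  · simp [Fin.prod_univ_two]
  · intro hnot
    rw [notMem_support_iff.mp hnot, zero_mul]

/-- The coefficient of `t^d` in `g(s p + t v)` is `g(v)`: it is the value at `(s, t) = (0, 1)`.
[folklore] -/
theorem coeff_single_one_lineRestrict {g : MvPolynomial (Fin (n + 1)) k} {d : ℕ}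
    (hg : g.IsHomogeneous d) (v : Fin (n + 1) → k) :
    coeff (Finsupp.single 1 d) (FanoScheme.lineRestrict p v g) = eval v g := by
  rw [← eval_zero_one_eq_coeff (isHomogeneous_lineRestrict p hg v), FanoScheme.eval_lineRestrict]
  simp

/-- **Strong lines, coefficientwise (ELV Lemma 1.1, `s = 0`, the incidence variety `H ⊋ H'`).**
For a form `g` of degree `d` with `g(p) = 0`: if the coefficients `Φⱼ` of `s^{d-j} tʲ` of the
universal restriction vanish at `v` for `1 ≤ j < d` ("the same equations, except the one for
`(0, …, 0, d - 1)`"), then every coefficient of `g(s p + t v)` other than that of `t^d` vanishes.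
[cite: EsnaultLevineViehweg1997, Lemma 1.1 and its proof (s = 0)] -/
theorem coeff_lineRestrict_eq_zero_of_ne {g : MvPolynomial (Fin (n + 1)) k} {d : ℕ}
    (hg : g.IsHomogeneous d) (hgp : eval p g = 0) {v : Fin (n + 1) → k}
    (hv : ∀ j, 1 ≤ j → j < d →
      eval v (coeff (Finsupp.single 0 (d - j) + Finsupp.single 1 j) (MvPolynomial.aeval (fun i : Fin (n + 1) =>
      (C (C (p i)) * X 0 + C (X i) * X 1 : MvPolynomial (Fin 2) (MvPolynomial (Fin (n + 1)) k))) g)) = 0)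
    {e : Fin 2 →₀ ℕ} (he : e ≠ Finsupp.single 1 d) :
    coeff e (FanoScheme.lineRestrict p v g) = 0 := by
  classical
  by_cases hdeg : e.degree = d
  · have hsum : e 0 + e 1 = d := by
      rw [Finsupp.degree_eq_sum, Fin.sum_univ_two] at hdeg
      exact hdeg
    have he' : e = Finsupp.single 0 (d - e 1) + Finsupp.single 1 (e 1) := by
      ext i
      fin_cases i
      · simp only [Fin.zero_eta, Fin.isValue, Finsupp.coe_add, Pi.add_apply,
          Finsupp.single_eq_same, Finsupp.single_apply]
        simp only [Fin.isValue, one_ne_zero, ↓reduceIte, add_zero]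
        omega
      · simp
    by_cases h1 : e 1 = 0
    · have he0 : e = Finsupp.single 0 d := by
        rw [he', h1, Nat.sub_zero, Finsupp.single_zero, add_zero]
      rw [he0, coeff_single_zero_lineRestrict p hg v, hgp]
    · by_cases h2 : e 1 = d
      · exfalso
        apply he
        rw [he', h2, Nat.sub_self, Finsupp.single_zero, zero_add]
      · rw [coeff_lineRestrict_eq_eval, he']
        exact hv (e 1) (Nat.one_le_iff_ne_zero.mpr h1) (lt_of_le_of_ne (by omega) h2)
  · exact (isHomogeneous_lineRestrict p hg v).coeff_eq_zero hdeg

/-- **Strong lines (ELV Lemma 1.1, `s = 0`).** Under the hypotheses of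
`coeff_lineRestrict_eq_zero_of_ne`, `g(s p + t v) = g(v) · t^d`: the line through `[p]` and `[v]`
meets `V₊(g)` only at `[p]` (with multiplicity `d`), or lies on `V₊(g)` when `g(v) = 0` — ELV's
"`H' ⊆ X` or `H' ∩ X = H`", `s = 0`. [cite: EsnaultLevineViehweg1997, Lemma 1.1 (s = 0)] -/
theorem lineRestrict_eq_C_mul_X_pow {g : MvPolynomial (Fin (n + 1)) k} {d : ℕ}
    (hg : g.IsHomogeneous d) (hgp : eval p g = 0) {v : Fin (n + 1) → k}
    (hv : ∀ j, 1 ≤ j → j < d →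
      eval v (coeff (Finsupp.single 0 (d - j) + Finsupp.single 1 j) (MvPolynomial.aeval (fun i : Fin (n + 1) =>
      (C (C (p i)) * X 0 + C (X i) * X 1 : MvPolynomial (Fin 2) (MvPolynomial (Fin (n + 1)) k))) g)) = 0) :
    FanoScheme.lineRestrict p v g = C (eval v g) * X 1 ^ d := by
  classical
  ext e
  rw [coeff_C_mul, coeff_X_pow]
  by_cases he : e = Finsupp.single 1 d
  · rw [he, coeff_single_one_lineRestrict p hg v, if_pos rfl, mul_one]
  · rw [coeff_lineRestrict_eq_zero_of_ne p hg hgp hv he, if_neg (Ne.symm he), mul_zero]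

end TaylorAlongLine

section LinesThroughPoints

variable {k : Type u} [Field k] {n : ℕ}

/-- **Lines through every point (Esnault–Levine–Viehweg, Lemma 1.1 for `s = 0`; proof of
Lemma 4.2 a)).** Let `k` be algebraically closed and `F₁, …, F_r ∈ k[x₀, …, xₙ]` forms of degrees
`d₁, …, d_r` with `Σᵢ dᵢ ≤ n - 1`. For every non-zero vector `p` on which all `Fᵢ` vanish there is a
vector `v`, linearly independent from `p`, such that every `Fᵢ` vanishes identically on the line
`s p + t v`: `Fᵢ(s p + t v) = 0` in `k[s, t]`. (ELV: the lines in `X = V₊(f)` through a point form a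
subscheme of `ℙⁿ⁻¹` "defined by `C(s+d, s+1)` equations", `s = 0`, non-empty if `d ≤ n - 1`; for
several equations the counts add — here via the tree's projective dimension theorem
`exists_ne_zero_common_zero_of_card_lt`.)
[cite: EsnaultLevineViehweg1997, Lemma 1.1 (s = 0) and proof of Lemma 4.2 a)] -/
theorem exists_linearIndependent_lineRestrict_eq_zero [IsAlgClosed k] {ι : Type*} [Fintype ι]
    (F : ι → MvPolynomial (Fin (n + 1)) k) (d : ι → ℕ) (hF : ∀ i, (F i).IsHomogeneous (d i))
    (hsum : ∑ i, d i + 1 ≤ n) {p : Fin (n + 1) → k} (hp : p ≠ 0) (hFp : ∀ i, eval p (F i) = 0) :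
    ∃ v : Fin (n + 1) → k, LinearIndependent k ![p, v] ∧
      ∀ i, FanoScheme.lineRestrict p v (F i) = 0 := by
  classical
  -- a coordinate where `p` does not vanish
  obtain ⟨m, hm⟩ : ∃ m, p m ≠ 0 := by
    by_contra h
    push Not at h
    exact hp (funext h)
  -- the universal restriction and its coefficients `Φ_{i,j}`, `1 ≤ j ≤ d i`
  let Λ : MvPolynomial (Fin (n + 1)) k →ₐ[k] MvPolynomial (Fin 2) (MvPolynomial (Fin (n + 1)) k) :=
    MvPolynomial.aeval (fun i : Fin (n + 1) =>
      (C (C (p i)) * X 0 + C (X i) * X 1 : MvPolynomial (Fin 2) (MvPolynomial (Fin (n + 1)) k)))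
  let Φ : (Σ i : ι, Fin (d i)) → MvPolynomial (Fin (n + 1)) k := fun ij =>
    coeff (Finsupp.single 0 (d ij.1 - (ij.2 + 1)) + Finsupp.single 1 ((ij.2 : ℕ) + 1)) (Λ (F ij.1))
  let s : Finset (MvPolynomial (Fin (n + 1)) k) :=
    insert (X m) (Finset.univ.image Φ)
  have h0 : ∀ q ∈ s, constantCoeff q = 0 := by
    intro q hq
    rcases Finset.mem_insert.mp hq with rfl | hq
    · exact constantCoeff_X k m
    · obtain ⟨ij, -, rfl⟩ := Finset.mem_image.mp hq
      exact constantCoeff_coeff_lineRestrictUniv p (hF ij.1) (hFp ij.1) _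
  have hcard : s.card < n + 1 := by
    calc s.card ≤ (Finset.univ.image Φ).card + 1 := Finset.card_insert_le _ _
      _ ≤ Fintype.card (Σ i : ι, Fin (d i)) + 1 := by
          gcongr
          exact Finset.card_image_le.trans Finset.card_univ.le
      _ = ∑ i, d i + 1 := by simp [Fintype.card_sigma]
      _ < n + 1 := by omega
  obtain ⟨v, hv0, hv⟩ :=
    Literature.RingTheory.KrullDimension.exists_ne_zero_common_zero_of_card_lt s h0 hcard
  have hvm : v m = 0 := by
    have := hv (X m) (Finset.mem_insert_self _ _)
    simpa using this
  refine ⟨v, ?_, fun i => ?_⟩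
  · -- `p, v` are independent: `v ≠ 0`, `v m = 0 ≠ p m`
    rw [LinearIndependent.pair_iff]
    intro a b hab
    have hm' := congr_fun hab m
    simp only [Pi.add_apply, Pi.smul_apply, smul_eq_mul, hvm, mul_zero, add_zero,
      Pi.zero_apply, mul_eq_zero] at hm'
    have ha : a = 0 := hm'.resolve_right hm
    refine ⟨ha, ?_⟩
    rw [ha, zero_smul, zero_add] at hab
    by_contra hb
    exact hv0 ((smul_eq_zero.mp hab).resolve_left hb)
  · refine lineRestrict_eq_zero_of_eval_coeff_eq_zero p (hF i) (hFp i) fun j hj hjd => ?_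
    have hmem : Φ ⟨i, ⟨j - 1, by omega⟩⟩ ∈ s :=
      Finset.mem_insert_of_mem (Finset.mem_image_of_mem Φ (Finset.mem_univ _))
    have h := hv _ hmem
    have hj' : j - 1 + 1 = j := by omega
    simp only [Φ, hj'] at h
    exact h

/-- **Through every point of `V₊(F₁, …, F_r)` passes a line of `V₊(F₁, …, F_r)`, if
`Σ deg Fᵢ ≤ n - 1`** — the same statement in the vocabulary of `Motives/FanoSchemeOfLinesPoints`:
for `k` algebraically closed, forms `Fᵢ` of degrees `dᵢ` with `Σᵢ dᵢ + 1 ≤ n`, and a non-zero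
common zero `p ∈ kⁿ⁺¹`, there is a `2`-plane `W ∋ p` in `FanoScheme.linesOn (Set.range F) k`, i.e. a
line `ℙ(W) ⊆ V₊(F) ⊆ ℙⁿ_k` through the point `[p]` (an `L`-point of the Fano scheme `F₁(V₊(F))` by
`FanoScheme.algPointsEquivLinesOn`). [cite: EsnaultLevineViehweg1997, Lemma 1.1 (s = 0) and Lemma 4.2 a)] -/
theorem exists_mem_linesOn_of_sum_degree_le [IsAlgClosed k] {ι : Type*} [Fintype ι]
    (F : ι → MvPolynomial (Fin (n + 1)) k) (d : ι → ℕ) (hF : ∀ i, (F i).IsHomogeneous (d i))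
    (hsum : ∑ i, d i + 1 ≤ n) {p : Fin (n + 1) → k} (hp : p ≠ 0) (hFp : ∀ i, eval p (F i) = 0) :
    ∃ W : Submodule k (Fin (n + 1) → k), W ∈ FanoScheme.linesOn (Set.range F) k ∧ p ∈ W := by
  obtain ⟨v, hpv, hv⟩ := exists_linearIndependent_lineRestrict_eq_zero F d hF hsum hp hFp
  refine ⟨Submodule.span k {p, v}, ?_, Submodule.subset_span (Set.mem_insert _ _)⟩
  rw [FanoScheme.span_pair_mem_linesOn_iff hpv]
  rintro g ⟨i, rfl⟩
  exact hv i

/-- **Strong lines through every point (Esnault–Levine–Viehweg, Lemma 1.1 for `s = 0`, the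
incidence variety `H`; Roitman's lines).** Let `k` be algebraically closed and `F₁, …, F_r` forms of
degrees `d₁, …, d_r ≥ 1` in `k[x₀, …, xₙ]` with `Σᵢ (dᵢ - 1) ≤ n - 1`. For every non-zero common zero
`p` of the `Fᵢ` there is a vector `v`, linearly independent from `p`, such that
`Fᵢ(s p + t v) = Fᵢ(v) · t^{dᵢ}` for all `i`: the line through `[p]` and `[v]` is *strong* for every
`V₊(Fᵢ)` — it lies on `V₊(Fᵢ)` or meets it in `[p]` alone (ELV: the fibres of `π₁ : H → Gr(s; X)`
are cut out by "`C(s+d, s+1) - 1` equations. In particular, `π₁` is surjective if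
`C(s+d, s+1) ≤ n - s`", `s = 0`: `d - 1` equations in `ℙⁿ⁻¹` per hypersurface).
[cite: EsnaultLevineViehweg1997, Lemma 1.1 (s = 0)] -/
theorem exists_linearIndependent_lineRestrict_eq_C_mul_X_pow [IsAlgClosed k] {ι : Type*} [Fintype ι]
    (F : ι → MvPolynomial (Fin (n + 1)) k) (d : ι → ℕ) (hF : ∀ i, (F i).IsHomogeneous (d i))
    (hsum : ∑ i, (d i - 1) + 1 ≤ n) {p : Fin (n + 1) → k} (hp : p ≠ 0)
    (hFp : ∀ i, eval p (F i) = 0) :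
    ∃ v : Fin (n + 1) → k, LinearIndependent k ![p, v] ∧
      ∀ i, FanoScheme.lineRestrict p v (F i) = C (eval v (F i)) * X 1 ^ d i := by
  classical
  obtain ⟨m, hm⟩ : ∃ m, p m ≠ 0 := by
    by_contra h
    push Not at h
    exact hp (funext h)
  let Λ : MvPolynomial (Fin (n + 1)) k →ₐ[k] MvPolynomial (Fin 2) (MvPolynomial (Fin (n + 1)) k) :=
    MvPolynomial.aeval (fun i : Fin (n + 1) =>
      (C (C (p i)) * X 0 + C (X i) * X 1 : MvPolynomial (Fin 2) (MvPolynomial (Fin (n + 1)) k)))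
  -- the coefficients `Φ_{i,j}`, `1 ≤ j ≤ d i - 1`
  let Φ : (Σ i : ι, Fin (d i - 1)) → MvPolynomial (Fin (n + 1)) k := fun ij =>
    coeff (Finsupp.single 0 (d ij.1 - (ij.2 + 1)) + Finsupp.single 1 ((ij.2 : ℕ) + 1)) (Λ (F ij.1))
  let s : Finset (MvPolynomial (Fin (n + 1)) k) :=
    insert (X m) (Finset.univ.image Φ)
  have h0 : ∀ q ∈ s, constantCoeff q = 0 := by
    intro q hq
    rcases Finset.mem_insert.mp hq with rfl | hq
    · exact constantCoeff_X k m
    · obtain ⟨ij, -, rfl⟩ := Finset.mem_image.mp hq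
      exact constantCoeff_coeff_lineRestrictUniv p (hF ij.1) (hFp ij.1) _
  have hcard : s.card < n + 1 := by
    calc s.card ≤ (Finset.univ.image Φ).card + 1 := Finset.card_insert_le _ _
      _ ≤ Fintype.card (Σ i : ι, Fin (d i - 1)) + 1 := by
          gcongr
          exact Finset.card_image_le.trans Finset.card_univ.le
      _ = ∑ i, (d i - 1) + 1 := by simp [Fintype.card_sigma]
      _ < n + 1 := by omega
  obtain ⟨v, hv0, hv⟩ :=
    Literature.RingTheory.KrullDimension.exists_ne_zero_common_zero_of_card_lt s h0 hcard
  have hvm : v m = 0 := by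
    have := hv (X m) (Finset.mem_insert_self _ _)
    simpa using this
  refine ⟨v, ?_, fun i => ?_⟩
  · rw [LinearIndependent.pair_iff]
    intro a b hab
    have hm' := congr_fun hab m
    simp only [Pi.add_apply, Pi.smul_apply, smul_eq_mul, hvm, mul_zero, add_zero,
      Pi.zero_apply, mul_eq_zero] at hm'
    have ha : a = 0 := hm'.resolve_right hm
    refine ⟨ha, ?_⟩
    rw [ha, zero_smul, zero_add] at hab
    by_contra hb
    exact hv0 ((smul_eq_zero.mp hab).resolve_left hb)
  · refine lineRestrict_eq_C_mul_X_pow p (hF i) (hFp i) fun j hj hjd => ?_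
    have hmem : Φ ⟨i, ⟨j - 1, by omega⟩⟩ ∈ s :=
      Finset.mem_insert_of_mem (Finset.mem_image_of_mem Φ (Finset.mem_univ _))
    have h := hv _ hmem
    have hj' : j - 1 + 1 = j := by omega
    simp only [Φ, hj'] at h
    exact h

/-- **A strong line meets `V₊(g)` only at `[p]`.** If `g(s p + t v) = g(v) · t^d` with `d ≥ 1` and
`g(v) ≠ 0`, then `g(s p + t v) = 0` forces `t = 0`: set-theoretically `ℙ(span(p, v)) ∩ V₊(g) = {[p]}`
(ELV's "`H' ∩ X = H`", `s = 0`). [cite: EsnaultLevineViehweg1997, Lemma 1.1 (s = 0)] -/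
theorem eq_zero_of_aeval_eq_zero_of_lineRestrict_eq {g : MvPolynomial (Fin (n + 1)) k} {d : ℕ}
    (hd : 0 < d) {p v : Fin (n + 1) → k}
    (hpv : FanoScheme.lineRestrict p v g = C (eval v g) * X 1 ^ d) (hgv : eval v g ≠ 0)
    {a b : k} (hab : aeval (a • p + b • v) g = 0) : b = 0 := by
  have h := FanoScheme.eval_lineRestrict p v g ![a, b]
  simp only [Matrix.cons_val_zero, Matrix.cons_val_one] at h
  rw [hab, hpv] at h
  simp only [map_mul, eval_C, map_pow, eval_X, Matrix.cons_val_one, Matrix.cons_val_fin_one] at h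
  have hb : b ^ d = 0 := (mul_eq_zero.mp h).resolve_left hgv
  exact pow_eq_zero_iff (Nat.pos_iff_ne_zero.mp hd) |>.mp hb

end LinesThroughPoints

section PlaneStep

variable {k : Type u} [Field k] {n s : ℕ} (p : Fin (s + 1) → Fin (n + 1) → k)

/-! The universal restriction `g ↦ g(τ y + Σ_a σ_a p_a) ∈ k[y][τ, σ₀, …, σ_s]` (`τ = X 0`,
`σ_a = X a.succ`) is written out in full as
`aeval (fun i => C (X i) * X 0 + ∑ a, C (C (p a i)) * X a.succ) g`. -/

/-- `planeRestrict (Fin.cons v p) g = g(τ v + Σ σ_a p_a)` with `τ = X 0`, `σ_a = X a.succ`.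
[folklore] -/
theorem planeRestrict_cons (v : Fin (n + 1) → k) (g : MvPolynomial (Fin (n + 1)) k) :
    FanoPlanes.planeRestrict (Fin.cons v p : Fin (s + 2) → Fin (n + 1) → k) g =
      aeval (fun i : Fin (n + 1) =>
        (C (v i) * X 0 + ∑ a : Fin (s + 1), C (p a i) * X a.succ : MvPolynomial (Fin (s + 2)) k)) g := by
  unfold FanoPlanes.planeRestrict
  have hfun : (fun i : Fin (n + 1) =>
      ∑ b : Fin (s + 2), C ((Fin.cons v p : Fin (s + 2) → Fin (n + 1) → k) b i) * X b) =
      fun i => (C (v i) * X 0 + ∑ a : Fin (s + 1), C (p a i) * X a.succ :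
        MvPolynomial (Fin (s + 2)) k) := by
    funext i
    rw [Fin.sum_univ_succ]
    simp only [Fin.cons_zero, Fin.cons_succ]
  rw [hfun]

/-- Specialising the universal restriction at `y = v` gives `planeRestrict (Fin.cons v p) g`.
[folklore] -/
theorem map_eval_planeRestrictUniv (g : MvPolynomial (Fin (n + 1)) k) (v : Fin (n + 1) → k) :
    MvPolynomial.map (eval v) (aeval (fun i : Fin (n + 1) =>
        (C (X i) * X 0 + ∑ a : Fin (s + 1), C (C (p a i)) * X a.succ :
          MvPolynomial (Fin (s + 2)) (MvPolynomial (Fin (n + 1)) k))) g) =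
      FanoPlanes.planeRestrict (Fin.cons v p : Fin (s + 2) → Fin (n + 1) → k) g := by
  rw [planeRestrict_cons]
  have key : (MvPolynomial.map (eval v)).comp (MvPolynomial.aeval (R := k) (fun i : Fin (n + 1) =>
        (C (X i) * X 0 + ∑ a : Fin (s + 1), C (C (p a i)) * X a.succ :
          MvPolynomial (Fin (s + 2)) (MvPolynomial (Fin (n + 1)) k)))).toRingHom =
      (aeval (fun i : Fin (n + 1) =>
        (C (v i) * X 0 + ∑ a : Fin (s + 1), C (p a i) * X a.succ : MvPolynomial (Fin (s + 2)) k)) :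
        MvPolynomial (Fin (n + 1)) k →ₐ[k] MvPolynomial (Fin (s + 2)) k).toRingHom := by
    apply MvPolynomial.ringHom_ext
    · intro c
      simp only [RingHom.coe_comp, AlgHom.toRingHom_eq_coe, RingHom.coe_coe, Function.comp_apply,
        aeval_C, MvPolynomial.algebraMap_apply, MvPolynomial.algebraMap_eq, map_C, eval_C]
    · intro i
      simp only [RingHom.coe_comp, AlgHom.toRingHom_eq_coe, RingHom.coe_coe, Function.comp_apply,
        aeval_X, map_add, map_mul, map_C, map_X, eval_X, map_sum, eval_C]
  exact RingHom.congr_fun key g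

/-- Coefficients of `planeRestrict (Fin.cons v p) g` are values at `v` of the coefficients of the
universal restriction. [folklore] -/
theorem coeff_planeRestrict_cons_eq_eval (g : MvPolynomial (Fin (n + 1)) k) (v : Fin (n + 1) → k)
    (e : Fin (s + 2) →₀ ℕ) :
    coeff e (FanoPlanes.planeRestrict (Fin.cons v p : Fin (s + 2) → Fin (n + 1) → k) g) =
      eval v (coeff e (aeval (fun i : Fin (n + 1) =>
        (C (X i) * X 0 + ∑ a : Fin (s + 1), C (C (p a i)) * X a.succ :
          MvPolynomial (Fin (s + 2)) (MvPolynomial (Fin (n + 1)) k))) g)) := by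
  rw [← map_eval_planeRestrictUniv p g v, coeff_map]

/-- The universal restriction of a form of degree `d` is a form of degree `d`. [folklore] -/
theorem isHomogeneous_planeRestrictUniv {g : MvPolynomial (Fin (n + 1)) k} {d : ℕ}
    (hg : g.IsHomogeneous d) :
    (aeval (fun i : Fin (n + 1) =>
        (C (X i) * X 0 + ∑ a : Fin (s + 1), C (C (p a i)) * X a.succ :
          MvPolynomial (Fin (s + 2)) (MvPolynomial (Fin (n + 1)) k))) g).IsHomogeneous d := by
  have h := hg.aeval (fun i : Fin (n + 1) =>
      (C (X i) * X 0 + ∑ a : Fin (s + 1), C (C (p a i)) * X a.succ :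
        MvPolynomial (Fin (s + 2)) (MvPolynomial (Fin (n + 1)) k))) (n := 1)
    (fun i => (isHomogeneous_C_mul_X _ _).add
      (IsHomogeneous.sum _ _ _ fun a _ => isHomogeneous_C_mul_X _ _))
  rwa [one_mul] at h

/-- `planeRestrict w g` of a form of degree `d` is a form of degree `d`. [folklore] -/
theorem isHomogeneous_planeRestrict {r : ℕ} (w : Fin (r + 1) → Fin (n + 1) → k)
    {g : MvPolynomial (Fin (n + 1)) k} {d : ℕ} (hg : g.IsHomogeneous d) :
    (FanoPlanes.planeRestrict w g).IsHomogeneous d := by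
  have h := hg.aeval (fun i : Fin (n + 1) =>
      (∑ a : Fin (r + 1), C (w a i) * X a : MvPolynomial (Fin (r + 1)) k)) (n := 1)
    (fun i => IsHomogeneous.sum _ _ _ fun a _ => isHomogeneous_C_mul_X _ _)
  rw [one_mul] at h
  exact h

/-- `planeRestrict p g`, re-indexed into `k[τ, σ]` by `σ_a ↦ X a.succ`, is the universal restriction
with `y` specialised to `0` (i.e. `g(0 + Σ σ_a p_a)`). [folklore] -/
theorem map_constantCoeff_planeRestrictUniv (g : MvPolynomial (Fin (n + 1)) k) :
    MvPolynomial.map (constantCoeff : MvPolynomial (Fin (n + 1)) k →+* k)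
        (aeval (fun i : Fin (n + 1) =>
          (C (X i) * X 0 + ∑ a : Fin (s + 1), C (C (p a i)) * X a.succ :
            MvPolynomial (Fin (s + 2)) (MvPolynomial (Fin (n + 1)) k))) g) =
      rename Fin.succ (FanoPlanes.planeRestrict p g) := by
  rw [← MvPolynomial.eval_zero, map_eval_planeRestrictUniv p g 0, planeRestrict_cons]
  unfold FanoPlanes.planeRestrict
  have key : (aeval (fun i : Fin (n + 1) =>
        (C ((0 : Fin (n + 1) → k) i) * X 0 + ∑ a : Fin (s + 1), C (p a i) * X a.succ :
          MvPolynomial (Fin (s + 2)) k)) : MvPolynomial (Fin (n + 1)) k →ₐ[k] _) =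
      (rename Fin.succ).comp (aeval fun i : Fin (n + 1) =>
        (∑ a : Fin (s + 1), C (p a i) * X a : MvPolynomial (Fin (s + 1)) k)) := by
    apply MvPolynomial.algHom_ext
    intro i
    simp only [aeval_X, Pi.zero_apply, C_0, zero_mul, zero_add, AlgHom.comp_apply, map_sum,
      map_mul, rename_C, rename_X]
  exact DFunLike.congr_fun key g

/-- If `g` vanishes identically on the plane spanned by `p`, every coefficient `Φ ∈ k[y]` of the
universal restriction `g(τ y + Σ σ_a p_a)` is a polynomial without constant term.
[cite: EsnaultLevineViehweg1997, proof of Lemma 1.1] -/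
theorem constantCoeff_coeff_planeRestrictUniv {g : MvPolynomial (Fin (n + 1)) k}
    (hgp : FanoPlanes.planeRestrict p g = 0) (e : Fin (s + 2) →₀ ℕ) :
    constantCoeff (coeff e (aeval (fun i : Fin (n + 1) =>
        (C (X i) * X 0 + ∑ a : Fin (s + 1), C (C (p a i)) * X a.succ :
          MvPolynomial (Fin (s + 2)) (MvPolynomial (Fin (n + 1)) k))) g)) = 0 := by
  have h := congr_arg (coeff e) (map_constantCoeff_planeRestrictUniv p g)
  rw [coeff_map, hgp, map_zero, coeff_zero] at h
  exact h

/-- Setting `τ = 0`: the `τ`-free part of `planeRestrict (Fin.cons v p) g` is `planeRestrict p g`.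
Precisely, `Polynomial.eval 0 (finSuccEquiv (planeRestrict (Fin.cons v p) g)) = planeRestrict p g`.
[folklore] -/
theorem eval_zero_finSuccEquiv_planeRestrict_cons (v : Fin (n + 1) → k)
    (g : MvPolynomial (Fin (n + 1)) k) :
    Polynomial.eval 0 (finSuccEquiv k (s + 1)
        (FanoPlanes.planeRestrict (Fin.cons v p : Fin (s + 2) → Fin (n + 1) → k) g)) =
      FanoPlanes.planeRestrict p g := by
  rw [planeRestrict_cons]
  unfold FanoPlanes.planeRestrict
  have key : ((Polynomial.evalRingHom (0 : MvPolynomial (Fin (s + 1)) k)).comp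
      (finSuccEquiv k (s + 1)).toRingEquiv.toRingHom).comp
        (aeval (fun i : Fin (n + 1) =>
          (C (v i) * X 0 + ∑ a : Fin (s + 1), C (p a i) * X a.succ : MvPolynomial (Fin (s + 2)) k)) :
          MvPolynomial (Fin (n + 1)) k →ₐ[k] _).toRingHom =
      (aeval (fun i : Fin (n + 1) =>
        (∑ a : Fin (s + 1), C (p a i) * X a : MvPolynomial (Fin (s + 1)) k)) :
        MvPolynomial (Fin (n + 1)) k →ₐ[k] _).toRingHom := by
    apply MvPolynomial.ringHom_ext
    · intro c
      simp only [RingHom.coe_comp, AlgHom.toRingHom_eq_coe, RingHom.coe_coe, Function.comp_apply,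
        aeval_C, MvPolynomial.algebraMap_eq, Polynomial.coe_evalRingHom]
      rw [show (finSuccEquiv k (s + 1)).toRingEquiv.toRingHom (C c) = finSuccEquiv k (s + 1) (C c)
        from rfl, finSuccEquiv_apply, eval₂Hom_C, RingHom.comp_apply, Polynomial.eval_C]
    · intro i
      simp only [RingHom.coe_comp, AlgHom.toRingHom_eq_coe, RingHom.coe_coe, Function.comp_apply,
        aeval_X, Polynomial.coe_evalRingHom]
      rw [show (finSuccEquiv k (s + 1)).toRingEquiv.toRingHom
          (C (v i) * X 0 + ∑ a : Fin (s + 1), C (p a i) * X a.succ) =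
          finSuccEquiv k (s + 1) (C (v i) * X 0 + ∑ a : Fin (s + 1), C (p a i) * X a.succ) from rfl]
      simp only [map_add, map_mul, map_sum, finSuccEquiv_X_zero, finSuccEquiv_X_succ,
        Polynomial.eval_add, Polynomial.eval_mul, Polynomial.eval_X, mul_zero, zero_add,
        Polynomial.eval_finsetSum, Polynomial.eval_C]
      refine Finset.sum_congr rfl fun a _ => ?_
      rw [finSuccEquiv_apply, eval₂Hom_C, RingHom.comp_apply, Polynomial.eval_C]
  exact RingHom.congr_fun key g

/-- The `τ`-free coefficients of `planeRestrict (Fin.cons v p) g` are the coefficients of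
`planeRestrict p g`; in particular they vanish when `g` vanishes identically on the plane of `p`.
[folklore] -/
theorem coeff_cons_zero_planeRestrict_cons (v : Fin (n + 1) → k) (g : MvPolynomial (Fin (n + 1)) k)
    (m : Fin (s + 1) →₀ ℕ) :
    coeff (Finsupp.cons 0 m)
        (FanoPlanes.planeRestrict (Fin.cons v p : Fin (s + 2) → Fin (n + 1) → k) g) =
      coeff m (FanoPlanes.planeRestrict p g) := by
  rw [← finSuccEquiv_coeff_coeff, Polynomial.coeff_zero_eq_eval_zero,
    eval_zero_finSuccEquiv_planeRestrict_cons]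

/-- Decomposition of an exponent with positive `τ`-degree: `e = (e - δ₀) + δ₀`. [folklore] -/
theorem sub_single_add_single {e : Fin (s + 2) →₀ ℕ} (he : e 0 ≠ 0) :
    e - Finsupp.single 0 1 + Finsupp.single 0 1 = e := by
  apply tsub_add_cancel_of_le
  intro i
  by_cases hi : i = 0
  · subst hi
    rw [Finsupp.single_eq_same]
    exact Nat.one_le_iff_ne_zero.mpr he
  · rw [Finsupp.single_eq_of_ne hi]
    exact Nat.zero_le _

/-- **Vanishing criterion (ELV Lemma 1.1, incidence `H'`, general `s`).** Let `g` be a form of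
degree `d ≥ 1` vanishing identically on the `s`-plane spanned by `p` (`planeRestrict p g = 0`). If
the coefficients `Φ_e ∈ k[y]` of the universal restriction `g(τ y + Σ σ_a p_a)` at all exponents
`e = β + δ₀` with `|β| = d - 1` (i.e. all exponents of positive `τ`-degree) vanish at `v`, then `g`
vanishes identically on the `(s+1)`-plane spanned by `v, p₀, …, p_s`:
`planeRestrict (Fin.cons v p) g = 0` (the `τ`-free coefficients are those of `planeRestrict p g = 0`,
the others vanish by hypothesis or by homogeneity).
[cite: EsnaultLevineViehweg1997, Lemma 1.1 and its proof] -/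
theorem planeRestrict_cons_eq_zero_of_eval_coeff_eq_zero {g : MvPolynomial (Fin (n + 1)) k} {d : ℕ}
    (hg : g.IsHomogeneous d) (hgp : FanoPlanes.planeRestrict p g = 0) {v : Fin (n + 1) → k}
    (hv : ∀ β : Fin (s + 2) →₀ ℕ, β.degree + 1 = d →
      eval v (coeff (β + Finsupp.single 0 1) (aeval (fun i : Fin (n + 1) =>
        (C (X i) * X 0 + ∑ a : Fin (s + 1), C (C (p a i)) * X a.succ :
          MvPolynomial (Fin (s + 2)) (MvPolynomial (Fin (n + 1)) k))) g)) = 0) :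
    FanoPlanes.planeRestrict (Fin.cons v p : Fin (s + 2) → Fin (n + 1) → k) g = 0 := by
  classical
  ext e
  rw [coeff_zero]
  by_cases hdeg : e.degree = d
  · by_cases h0 : e 0 = 0
    · -- `τ`-free coefficient: a coefficient of `planeRestrict p g = 0`
      rw [← Finsupp.cons_tail e, h0, coeff_cons_zero_planeRestrict_cons, hgp, coeff_zero]
    · -- positive `τ`-degree: `e = β + δ₀`
      have he : e - Finsupp.single 0 1 + Finsupp.single 0 1 = e := sub_single_add_single h0
      have hβ : (e - Finsupp.single 0 1).degree + 1 = d := by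
        have h := congr_arg Finsupp.degree he
        rw [map_add, Finsupp.degree_single, hdeg] at h
        exact h
      rw [coeff_planeRestrict_cons_eq_eval, ← he]
      exact hv _ hβ
  · exact (isHomogeneous_planeRestrict _ hg).coeff_eq_zero hdeg

end PlaneStep

section PlaneExistence

variable {k : Type u} [Field k] {n : ℕ}

/-- **Dual linear forms.** For linearly independent vectors `p₀, …, p_s ∈ kⁿ⁺¹` there are linear
forms `L₀, …, L_s ∈ k[y₀, …, yₙ]` (polynomials without constant term) with
`L_b(Σ_a c_a p_a) = c_b` (a left inverse of `c ↦ Σ c_a p_a`, Mathlib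
`LinearMap.exists_leftInverse_of_injective`). [folklore] -/
theorem exists_linearForms_dual {s : ℕ} {p : Fin (s + 1) → Fin (n + 1) → k}
    (hp : LinearIndependent k p) :
    ∃ Lf : Fin (s + 1) → MvPolynomial (Fin (n + 1)) k,
      (∀ b, constantCoeff (Lf b) = 0) ∧
      ∀ (c : Fin (s + 1) → k) (b : Fin (s + 1)), eval (∑ a, c a • p a) (Lf b) = c b := by
  classical
  obtain ⟨g, hg⟩ := (Finsupp.linearCombination k p).exists_leftInverse_of_injective
    (linearIndependent_iff_ker.mp hp)
  let lam : Fin (s + 1) → (Fin (n + 1) → k) →ₗ[k] k := fun b => (Finsupp.lapply b).comp g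
  refine ⟨fun b => ∑ j : Fin (n + 1), C (lam b fun j' => if j = j' then 1 else 0) * X j,
    fun b => ?_, fun c b => ?_⟩
  · simp only [map_sum, map_mul, constantCoeff_C, constantCoeff_X, mul_zero,
      Finset.sum_const_zero]
  · have h1 : eval (∑ a, c a • p a) (∑ j : Fin (n + 1), C (lam b fun j' => if j = j' then 1 else 0)
        * X j) = lam b (∑ a, c a • p a) := by
      rw [LinearMap.pi_apply_eq_sum_univ (lam b) (∑ a, c a • p a)]
      simp only [map_sum, map_mul, eval_C, eval_X, smul_eq_mul]
      exact Finset.sum_congr rfl fun j _ => mul_comm _ _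
    rw [h1]
    have h2 : (∑ a, c a • p a) = Finsupp.linearCombination k p (∑ a, Finsupp.single a (c a)) := by
      rw [map_sum]
      exact Finset.sum_congr rfl fun a _ => (Finsupp.linearCombination_single k (c a) a).symm
    have h3 : g (Finsupp.linearCombination k p (∑ a, Finsupp.single a (c a))) =
        ∑ a, Finsupp.single a (c a) := by
      have := LinearMap.congr_fun hg (∑ a, Finsupp.single a (c a))
      simpa using this
    simp only [lam, LinearMap.comp_apply, Finsupp.lapply_apply]
    rw [h2, h3, Finsupp.finsetSum_apply]
    simp [Finsupp.single_apply]

/-- **Extending a plane on `V₊(F)` by one dimension (Esnault–Levine–Viehweg, Lemma 1.1: the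
fibres of `π'₁ : H' → Gr(s; X)` are non-empty if `Σᵢ C(s + dᵢ, s + 1) ≤ n - s - 1`).** Let `k` be
algebraically closed, `F₁, …, F_r` forms of degrees `dᵢ ≥ 1` in `k[x₀, …, xₙ]`, and `p₀, …, p_s`
linearly independent vectors spanning an `s`-plane `H = ℙ(span p) ⊆ V₊(F₁, …, F_r)` (every `Fᵢ`
vanishes identically on it: `planeRestrict p Fᵢ = 0`). If `Σᵢ C(dᵢ + s, s + 1) ≤ n - s - 1`, there
is a vector `v` such that `v, p₀, …, p_s` are linearly independent and span an `(s+1)`-plane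
`H' ⊇ H` on `V₊(F₁, …, F_r)` (ELV: "the fibers of `π₁` (or `π'₁`) are subschemes of `ℙ^{n-s-1}`
defined by `C(s+d, s+1) - 1` (or `C(s+d, s+1)`) equations. In particular, `π₁` (or `π'₁`) is
surjective if `C(s+d, s+1) ≤ n - s` (or `C(s+d, s+1) ≤ n - s - 1`)"; for several equations the
counts add, as in the proof of Lemma 4.2). Proof: the coefficients of positive `τ`-degree of the
universal restriction `Fᵢ(τ y + Σ σ_a p_a)` are `Σᵢ C(dᵢ + s, s + 1)` polynomials in `y` without
constant term (stars and bars, Mathlib `Sym.card_sym_eq_choose`), the `s + 1` dual linear forms of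
`p` force `v ∉ span p`, and `< n + 1` such polynomials have a common non-trivial zero
(`exists_ne_zero_common_zero_of_card_lt`). [cite: EsnaultLevineViehweg1997, Lemma 1.1 and proof of Lemma 4.2 a)] -/
theorem exists_planeRestrict_cons_eq_zero [IsAlgClosed k] {ι : Type*} [Fintype ι]
    (F : ι → MvPolynomial (Fin (n + 1)) k) (d : ι → ℕ) (hF : ∀ i, (F i).IsHomogeneous (d i))
    (hd : ∀ i, 0 < d i) {s : ℕ} {p : Fin (s + 1) → Fin (n + 1) → k} (hp : LinearIndependent k p)
    (hFp : ∀ i, FanoPlanes.planeRestrict p (F i) = 0)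
    (hsum : ∑ i, Nat.choose (d i + s) (s + 1) + s + 2 ≤ n + 1) :
    ∃ v : Fin (n + 1) → k, LinearIndependent k (Fin.cons v p : Fin (s + 2) → Fin (n + 1) → k) ∧
      ∀ i, FanoPlanes.planeRestrict (Fin.cons v p : Fin (s + 2) → Fin (n + 1) → k) (F i) = 0 := by
  classical
  obtain ⟨Lf, hLf0, hLf⟩ := exists_linearForms_dual hp
  -- the coefficients of positive `τ`-degree of the universal restrictions
  let Φ : (Σ i : ι, Sym (Fin (s + 2)) (d i - 1)) → MvPolynomial (Fin (n + 1)) k := fun iβ =>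
    coeff (Multiset.toFinsupp (iβ.2 : Multiset (Fin (s + 2))) + Finsupp.single 0 1)
      (aeval (fun j : Fin (n + 1) =>
        (C (X j) * X 0 + ∑ a : Fin (s + 1), C (C (p a j)) * X a.succ :
          MvPolynomial (Fin (s + 2)) (MvPolynomial (Fin (n + 1)) k))) (F iβ.1))
  let T : Finset (MvPolynomial (Fin (n + 1)) k) :=
    Finset.univ.image Lf ∪ Finset.univ.image Φ
  have h0 : ∀ q ∈ T, constantCoeff q = 0 := by
    intro q hq
    rcases Finset.mem_union.mp hq with hq | hq
    · obtain ⟨b, -, rfl⟩ := Finset.mem_image.mp hq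
      exact hLf0 b
    · obtain ⟨iβ, -, rfl⟩ := Finset.mem_image.mp hq
      exact constantCoeff_coeff_planeRestrictUniv p (hFp iβ.1) _
  have hcardSym : ∀ i, Fintype.card (Sym (Fin (s + 2)) (d i - 1)) = Nat.choose (d i + s) (s + 1) := by
    intro i
    rw [Sym.card_sym_eq_choose, Fintype.card_fin]
    have h1 : s + 2 + (d i - 1) - 1 = d i - 1 + (s + 1) := by have := hd i; omega
    have h2 : d i + s = d i - 1 + (s + 1) := by have := hd i; omega
    rw [h1, h2]
    exact Nat.choose_symm_add
  have hcard : T.card < n + 1 := by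
    calc T.card ≤ (Finset.univ.image Lf).card + (Finset.univ.image Φ).card :=
          Finset.card_union_le _ _
      _ ≤ Fintype.card (Fin (s + 1)) + Fintype.card (Σ i : ι, Sym (Fin (s + 2)) (d i - 1)) := by
          gcongr <;> exact Finset.card_image_le.trans Finset.card_univ.le
      _ = (s + 1) + ∑ i, Nat.choose (d i + s) (s + 1) := by
          rw [Fintype.card_fin, Fintype.card_sigma]
          simp_rw [hcardSym]
      _ < n + 1 := by omega
  obtain ⟨v, hv0, hv⟩ :=
    Literature.RingTheory.KrullDimension.exists_ne_zero_common_zero_of_card_lt T h0 hcard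
  refine ⟨v, ?_, fun i => ?_⟩
  · -- independence: the dual forms of `p` vanish at `v`, so `v ∉ span p` (as `v ≠ 0`)
    rw [linearIndependent_finCons]
    refine ⟨hp, fun hmem => hv0 ?_⟩
    obtain ⟨c, hc⟩ := (_root_.Submodule.mem_span_range_iff_exists_fun k).mp hmem
    have hc0 : ∀ b, c b = 0 := by
      intro b
      rw [← hLf c b, hc]
      exact hv (Lf b) (Finset.mem_union_left _ (Finset.mem_image_of_mem Lf (Finset.mem_univ b)))
    rw [← hc]
    exact Finset.sum_eq_zero fun a _ => by rw [hc0 a, zero_smul]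
  · refine planeRestrict_cons_eq_zero_of_eval_coeff_eq_zero p (hF i) (hFp i) fun β hβ => ?_
    let βs : Sym (Fin (s + 2)) (d i - 1) := ⟨Finsupp.toMultiset β, by
      rw [Finsupp.card_toMultiset]
      change β.degree = d i - 1
      omega⟩
    have hmem : Φ ⟨i, βs⟩ ∈ T :=
      Finset.mem_union_right _ (Finset.mem_image_of_mem Φ (Finset.mem_univ _))
    have h := hv _ hmem
    simp only [Φ, βs, Sym.coe_mk, Finsupp.toMultiset_toFinsupp] at h
    exact h

/-- **A `0`-plane through a point of `V₊(F)`**: for a form `g` with `g(p₀) = 0`, `g` vanishes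
identically on the line `k p₀` (`g(σ p₀) = σ^d g(p₀) = 0`, Euler). [folklore] -/
theorem planeRestrict_const_eq_zero {g : MvPolynomial (Fin (n + 1)) k} {d : ℕ}
    (hg : g.IsHomogeneous d) {p₀ : Fin (n + 1) → k} (hgp : eval p₀ g = 0) :
    FanoPlanes.planeRestrict (fun _ : Fin 1 => p₀) g = 0 := by
  unfold FanoPlanes.planeRestrict
  have hfun : (fun i : Fin (n + 1) => ∑ a : Fin 1, C ((fun _ : Fin 1 => p₀) a i) * X a) =
      fun i => (X 0 * C (p₀ i) : MvPolynomial (Fin 1) k) := by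
    funext i
    rw [Fin.sum_univ_one, mul_comm]
  rw [hfun, ProjectiveSpace.isHomogeneous_aeval_const_mul hg (X 0) (fun i => C (p₀ i))]
  have h3 := aeval_C_comp g (R := MvPolynomial (Fin 1) k) p₀
  simp only [algebraMap_eq, MvPolynomial.aeval_eq_eval] at h3
  rw [h3, hgp, C_0, mul_zero]

/-- **Planes through every point of `V₊(F₁, …, F_r)` (Esnault–Levine–Viehweg, Lemma 4.2 a), by
induction on `l` from Lemma 1.1).** Let `k` be algebraically closed and `F₁, …, F_r` forms of
degrees `dᵢ ≥ 1` in `k[x₀, …, xₙ]` such that `Σᵢ C(dᵢ + s, s + 1) ≤ n - s - 1` for all `s < l`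
(equivalently, by monotonicity, for `s = l - 1`: `Σᵢ C(dᵢ + l - 1, l) ≤ n - l`, ELV's inequality
(14) with `≤`). Then through every point `[p₀]` of `V₊(F₁, …, F_r)` there passes an `l`-plane
contained in `V₊(F₁, …, F_r)`: there are linearly independent `p₀', …, p_l'` with `p_l' = p₀` on whose
span every `Fᵢ` vanishes identically (`planeRestrict p Fᵢ = 0`; these are the `k`-points of the Fano
scheme `F_l(V₊(F))`, `FanoPlanes.planePoint`). ELV: "So we may assume by induction on `l` that …
for all `x ∈ X_v` there exists some `H ∈ Gr_k(l-1; X_v)`, passing through `x`. … `Gr_k(l; X_v)_H` [is]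
a subscheme of `ℙ^{n-l}_k`, defined by `Σᵢ C(dᵢ + l - 1, l)` equations."
[cite: EsnaultLevineViehweg1997, Lemma 4.2 a) and its proof] -/
theorem exists_plane_through_point [IsAlgClosed k] {ι : Type*} [Fintype ι]
    (F : ι → MvPolynomial (Fin (n + 1)) k) (d : ι → ℕ) (hF : ∀ i, (F i).IsHomogeneous (d i))
    (hd : ∀ i, 0 < d i) (l : ℕ)
    (hsum : ∀ s, s < l → ∑ i, Nat.choose (d i + s) (s + 1) + s + 2 ≤ n + 1)
    {p₀ : Fin (n + 1) → k} (hp₀ : p₀ ≠ 0) (hFp : ∀ i, eval p₀ (F i) = 0) :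
    ∃ p : Fin (l + 1) → Fin (n + 1) → k, LinearIndependent k p ∧ p (Fin.last l) = p₀ ∧
      ∀ i, FanoPlanes.planeRestrict p (F i) = 0 := by
  induction l with
  | zero =>
    refine ⟨fun _ => p₀, ?_, rfl, fun i => planeRestrict_const_eq_zero (hF i) (hFp i)⟩
    change LinearIndependent k (fun _ : Fin 1 => p₀)
    rw [linearIndependent_unique_iff]
    exact hp₀
  | succ l ih =>
    obtain ⟨p, hp, hlast, hFp'⟩ := ih fun s hs => hsum s (Nat.lt_succ_of_lt hs)
    obtain ⟨v, hv, hFv⟩ := exists_planeRestrict_cons_eq_zero F d hF hd hp hFp'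
      (hsum l (Nat.lt_succ_self l))
    refine ⟨Fin.cons v p, hv, ?_, hFv⟩
    rw [← Fin.succ_last, Fin.cons_succ, hlast]

/-- Monotonicity of ELV's count: `s ↦ Σᵢ C(dᵢ + s, s + 1) + s` is non-decreasing (Pascal's rule).
[folklore] -/
theorem sum_choose_add_mono {ι : Type*} [Fintype ι] (d : ι → ℕ) {s t : ℕ} (hst : s ≤ t) :
    ∑ i, Nat.choose (d i + s) (s + 1) + s ≤ ∑ i, Nat.choose (d i + t) (t + 1) + t := by
  have hmono : Monotone (fun s => ∑ i, Nat.choose (d i + s) (s + 1) + s) := by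
    refine monotone_nat_of_le_succ fun t => ?_
    have hterm : ∀ i, Nat.choose (d i + t) (t + 1) ≤ Nat.choose (d i + (t + 1)) (t + 1 + 1) := by
      intro i
      rw [show d i + (t + 1) = (d i + t) + 1 from rfl, Nat.choose_succ_succ']
      exact Nat.le_add_right _ _
    have := Finset.sum_le_sum fun i (_ : i ∈ Finset.univ) => hterm i
    show (∑ i, Nat.choose (d i + t) (t + 1) + t) ≤
      ∑ i, Nat.choose (d i + (t + 1)) (t + 1 + 1) + (t + 1)
    omega
  exact hmono hst

/-- **Lemma 4.2 a) with a single inequality**: if `l ≥ 1` and `Σᵢ C(dᵢ + l - 1, l) ≤ n - l`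
(ELV's count (14), non-strict), every point of `V₊(F₁, …, F_r)` lies on an `l`-plane of
`V₊(F₁, …, F_r)`. [cite: EsnaultLevineViehweg1997, Lemma 4.2 a) and its proof] -/
theorem exists_plane_through_point_of_le [IsAlgClosed k] {ι : Type*} [Fintype ι]
    (F : ι → MvPolynomial (Fin (n + 1)) k) (d : ι → ℕ) (hF : ∀ i, (F i).IsHomogeneous (d i))
    (hd : ∀ i, 0 < d i) {l : ℕ} (hl : 0 < l)
    (hsum : ∑ i, Nat.choose (d i + (l - 1)) l + l ≤ n)
    {p₀ : Fin (n + 1) → k} (hp₀ : p₀ ≠ 0) (hFp : ∀ i, eval p₀ (F i) = 0) :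
    ∃ p : Fin (l + 1) → Fin (n + 1) → k, LinearIndependent k p ∧ p (Fin.last l) = p₀ ∧
      ∀ i, FanoPlanes.planeRestrict p (F i) = 0 := by
  refine exists_plane_through_point F d hF hd l (fun s hs => ?_) hp₀ hFp
  have hmono := sum_choose_add_mono d (show s ≤ l - 1 by omega)
  have hl1 : l - 1 + 1 = l := by omega
  rw [hl1] at hmono
  omega

/-- **ELV's hypothesis (13) implies the count (14) (non-strict)**: if all `dᵢ ≥ 2`, some `dᵢ ≥ 3`
or `r ≥ l`, and `Σᵢ C(dᵢ + l, l + 1) ≤ n`, then `Σᵢ C(dᵢ + l - 1, l) ≤ n - l` — by Pascal's rule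
`C(d + l, l + 1) = C(d + l - 1, l) + C(d + l - 1, l + 1)` and `Σᵢ C(dᵢ + l - 1, l + 1) ≥ l`
(ELV, proof of Lemma 4.2: "(13) implies (14) if (15) …; the inequality (15) is satisfied if
`d₁ ≥ 3`, or if `r ≥ l + 1`"; the non-strict form needs only `r ≥ l`).
[cite: EsnaultLevineViehweg1997, proof of Lemma 4.2] -/
theorem sum_choose_le_of_hypothesis13 {ι : Type*} [Fintype ι] (d : ι → ℕ) (hd : ∀ i, 2 ≤ d i)
    {l n : ℕ} (hl : 0 < l) (h3 : (∃ i, 3 ≤ d i) ∨ l ≤ Fintype.card ι)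
    (h13 : ∑ i, Nat.choose (d i + l) (l + 1) ≤ n) :
    ∑ i, Nat.choose (d i + (l - 1)) l + l ≤ n := by
  classical
  obtain ⟨l, rfl⟩ : ∃ l', l = l' + 1 := ⟨l - 1, by omega⟩
  simp only [Nat.add_sub_cancel]
  have hpascal : ∀ i, Nat.choose (d i + (l + 1)) (l + 1 + 1) =
      Nat.choose (d i + l) (l + 1) + Nat.choose (d i + l) (l + 1 + 1) := by
    intro i
    rw [show d i + (l + 1) = (d i + l) + 1 from rfl, Nat.choose_succ_succ']
  have hsplit : ∑ i, Nat.choose (d i + (l + 1)) (l + 1 + 1) =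
      ∑ i, Nat.choose (d i + l) (l + 1) + ∑ i, Nat.choose (d i + l) (l + 1 + 1) := by
    rw [← Finset.sum_add_distrib]
    exact Finset.sum_congr rfl fun i _ => hpascal i
  have hge : l + 1 ≤ ∑ i, Nat.choose (d i + l) (l + 1 + 1) := by
    rcases h3 with ⟨i₀, hi₀⟩ | hr
    · have h1 : Nat.choose (l + 1 + 2) (l + 1 + 1) ≤ Nat.choose (d i₀ + l) (l + 1 + 1) :=
        Nat.choose_le_choose _ (by omega)
      have h2 : Nat.choose (l + 1 + 2) (l + 1 + 1) = l + 1 + 2 := by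
        rw [show l + 1 + 2 = (l + 1 + 1) + 1 from rfl, Nat.choose_succ_self_right]
      have h3 : Nat.choose (d i₀ + l) (l + 1 + 1) ≤ ∑ i, Nat.choose (d i + l) (l + 1 + 1) :=
        Finset.single_le_sum (f := fun i => Nat.choose (d i + l) (l + 1 + 1))
          (fun i _ => Nat.zero_le _) (Finset.mem_univ i₀)
      omega
    · have h1 : ∀ i, 1 ≤ Nat.choose (d i + l) (l + 1 + 1) := by
        intro i
        have := Nat.choose_le_choose (l + 1 + 1) (show l + 1 + 1 ≤ d i + l by have := hd i; omega)
        rwa [Nat.choose_self] at this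
      have h2 : ∑ _i : ι, (1 : ℕ) ≤ ∑ i, Nat.choose (d i + l) (l + 1 + 1) :=
        Finset.sum_le_sum fun i _ => h1 i
      rw [Finset.sum_const, Finset.card_univ, smul_eq_mul, mul_one] at h2
      omega
  omega

/-- **Lemma 4.2 a) under ELV's printed hypothesis (13)** (first bullet of Thm. 4.6, non-strict
form): for forms `F₁, …, F_r` of degrees `dᵢ ≥ 2` over an algebraically closed field with
`Σᵢ C(dᵢ + l, l + 1) ≤ n` and (`some dᵢ ≥ 3` or `r ≥ l`), through every point of `V₊(F₁, …, F_r)`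
there passes an `l`-plane contained in `V₊(F₁, …, F_r)` ("for each `v ∈ V(n; d₁, …, d_r)_k` and for
each point `x ∈ X_v` there exists an `l`-plane `H ∈ Gr_k(l; X_v)` which contains `x`").
[cite: EsnaultLevineViehweg1997, Lemma 4.2 a)] -/
theorem exists_plane_through_point_of_hypothesis13 [IsAlgClosed k] {ι : Type*} [Fintype ι]
    (F : ι → MvPolynomial (Fin (n + 1)) k) (d : ι → ℕ) (hF : ∀ i, (F i).IsHomogeneous (d i))
    (hd : ∀ i, 2 ≤ d i) (l : ℕ) (h3 : (∃ i, 3 ≤ d i) ∨ l ≤ Fintype.card ι)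
    (h13 : ∑ i, Nat.choose (d i + l) (l + 1) ≤ n)
    {p₀ : Fin (n + 1) → k} (hp₀ : p₀ ≠ 0) (hFp : ∀ i, eval p₀ (F i) = 0) :
    ∃ p : Fin (l + 1) → Fin (n + 1) → k, LinearIndependent k p ∧ p (Fin.last l) = p₀ ∧
      ∀ i, FanoPlanes.planeRestrict p (F i) = 0 := by
  rcases Nat.eq_zero_or_pos l with rfl | hl
  · exact exists_plane_through_point F d hF (fun i => by have := hd i; omega) 0
      (fun s hs => absurd hs (Nat.not_lt_zero s)) hp₀ hFp
  · exact exists_plane_through_point_of_le F d hF (fun i => by have := hd i; omega) hl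
      (sum_choose_le_of_hypothesis13 d hd hl h3 h13) hp₀ hFp

/-- **ELV Lemma 4.5 (first case): the hypothesis (13) propagates strictly to all lower levels.**
If all `dᵢ ≥ 2`, some `dᵢ ≥ 3` or `r ≥ l`, and `Σᵢ C(dᵢ + l, l + 1) ≤ n` (ELV (13)), then
`Σᵢ C(dᵢ + s, s + 1) < n - s` for all `s < l` (ELV (16)); printed: "Let `d₁, …, d_r, l` be positive
integers. If `d₁ ≥ 3`, or if `r ≥ l - 1` [sic], then the inequality `Σ C(dᵢ + l, l + 1) ≤ n` implies
the inequality `Σ C(dᵢ + s, s + 1) < n - s` (16) for all `s < l`" (the printed proof uses the single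
`i` with `dᵢ ≥ 3`, or, when all `dᵢ = 2`, the count `r(l + 1) ≤ n - r`; the latter needs `r ≥ l`, the
form proved here, which covers Thm. 4.6's `r ≥ l + 1`). Rendered without `ℕ`-subtraction as
`Σᵢ C(dᵢ + s, s + 1) + s + 1 ≤ n`. [cite: EsnaultLevineViehweg1997, Lemma 4.5] -/
theorem sum_choose_lt_of_hypothesis13 {ι : Type*} [Fintype ι] (d : ι → ℕ) (hd : ∀ i, 2 ≤ d i)
    {l n : ℕ} (h3 : (∃ i, 3 ≤ d i) ∨ l ≤ Fintype.card ι)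
    (h13 : ∑ i, Nat.choose (d i + l) (l + 1) ≤ n) {s : ℕ} (hs : s < l) :
    ∑ i, Nat.choose (d i + s) (s + 1) + s + 1 ≤ n := by
  have hl : 0 < l := by omega
  have htop := sum_choose_le_of_hypothesis13 d hd hl h3 h13
  have hmono := sum_choose_add_mono d (show s ≤ l - 1 by omega)
  have hl1 : l - 1 + 1 = l := by omega
  rw [hl1] at hmono
  omega

/-- **ELV Lemma 4.5 (second case, all degrees `2`)**: if `dᵢ = 2` for all `i`, `1 ≤ r ≤ l` and
`r(l + 2) ≤ n + r - l - 1` (the second bullet of Thm. 4.6 / Lemma 4.2), then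
`Σᵢ C(dᵢ + s, s + 1) = r(s + 2) < n - s` for all `s < l`; printed: "If `d₁ = 2` and `1 ≤ r ≤ l`, then
the inequality `r(l + 2) ≤ n + r - l - 1`, implies the inequality (16) for all `s < l`." Rendered
without `ℕ`-subtraction (hypothesis as `r(l + 2) + l + 1 ≤ n + r`).
[cite: EsnaultLevineViehweg1997, Lemma 4.5] -/
theorem sum_choose_lt_of_quadrics {ι : Type*} [Fintype ι] (d : ι → ℕ) (hd : ∀ i, d i = 2)
    {l n : ℕ} (hq : Fintype.card ι * (l + 2) + l + 1 ≤ n + Fintype.card ι) {s : ℕ} (hs : s < l) :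
    ∑ i, Nat.choose (d i + s) (s + 1) + s + 1 ≤ n := by
  classical
  have hsum : ∀ t : ℕ, ∑ i, Nat.choose (d i + t) (t + 1) = Fintype.card ι * (t + 2) := by
    intro t
    have h1 : ∀ i, Nat.choose (d i + t) (t + 1) = t + 2 := by
      intro i
      rw [hd i, show 2 + t = (t + 1) + 1 by omega, Nat.choose_succ_self_right]
    simp_rw [h1]
    rw [Finset.sum_const, Finset.card_univ, smul_eq_mul]
  rw [hsum]
  have hmono : Fintype.card ι * (s + 2) + s ≤ Fintype.card ι * (l - 1 + 2) + (l - 1) := by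
    have : s + 2 ≤ l - 1 + 2 := by omega
    have := Nat.mul_le_mul_left (Fintype.card ι) this
    omega
  have hl : l - 1 + 2 = l + 1 := by omega
  rw [hl] at hmono
  have hkey : Fintype.card ι * (l + 1) + l ≤ n := by
    have : Fintype.card ι * (l + 2) = Fintype.card ι * (l + 1) + Fintype.card ι := by ring
    omega
  omega

/-- **Lemma 4.2 a) for intersections of quadrics (second bullet)**: for forms `F₁, …, F_r` all of
degree `2` over an algebraically closed field with `r(l + 2) ≤ n + r - l - 1` (rendered
`r(l + 2) + l + 1 ≤ n + r`; ELV also assume `1 ≤ r ≤ l`, not needed here), through every point of `V₊(F₁, …, F_r)` there passes an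
`l`-plane contained in `V₊(F₁, …, F_r)` ("If `d₁ = 2` and `1 ≤ r ≤ l`, the same conclusions hold if
`r(l + 2) ≤ n + r - l - 1`"). [cite: EsnaultLevineViehweg1997, Lemma 4.2 a) (case d₁ = 2)] -/
theorem exists_plane_through_point_of_quadrics [IsAlgClosed k] {ι : Type*} [Fintype ι]
    (F : ι → MvPolynomial (Fin (n + 1)) k) (hF : ∀ i, (F i).IsHomogeneous 2) (l : ℕ)
    (hq : Fintype.card ι * (l + 2) + l + 1 ≤ n + Fintype.card ι)
    {p₀ : Fin (n + 1) → k} (hp₀ : p₀ ≠ 0) (hFp : ∀ i, eval p₀ (F i) = 0) :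
    ∃ p : Fin (l + 1) → Fin (n + 1) → k, LinearIndependent k p ∧ p (Fin.last l) = p₀ ∧
      ∀ i, FanoPlanes.planeRestrict p (F i) = 0 := by
  refine exists_plane_through_point F (fun _ => 2) (fun i => hF i) (fun _ => two_pos) l
    (fun s hs => ?_) hp₀ hFp
  have h := sum_choose_lt_of_quadrics (fun _ : ι => 2) (fun _ => rfl) hq hs
  omega

end PlaneExistence

section StrongPlanes

variable {k : Type u} [Field k] {n : ℕ}

/-- `g(Σ σ_b w_b)` evaluated at `σ = c` is `g(Σ c_b w_b)`. [folklore] -/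
theorem eval_planeRestrict {r : ℕ} (w : Fin (r + 1) → Fin (n + 1) → k)
    (g : MvPolynomial (Fin (n + 1)) k) (c : Fin (r + 1) → k) :
    eval c (FanoPlanes.planeRestrict w g) = aeval (∑ b, c b • w b) g := by
  unfold FanoPlanes.planeRestrict
  have key : (aeval (∑ b, c b • w b) : MvPolynomial (Fin (n + 1)) k →ₐ[k] k) =
      ((aeval c : MvPolynomial (Fin (r + 1)) k →ₐ[k] k)).comp
        (aeval fun i => (∑ b : Fin (r + 1), C (w b i) * X b : MvPolynomial (Fin (r + 1)) k)) := by
    apply MvPolynomial.algHom_ext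
    intro i
    simp only [aeval_X, AlgHom.comp_apply, map_sum, map_mul, aeval_C, Algebra.algebraMap_self_apply,
      Finset.sum_apply, Pi.smul_apply, smul_eq_mul]
    exact Finset.sum_congr rfl fun b _ => mul_comm _ _
  have h := DFunLike.congr_fun key g
  rw [h]
  rfl

/-- For a form `G(τ, σ₀, …, σ_s)` of degree `d`, `G(1, 0, …, 0)` is the coefficient of `τ^d`.
[folklore] -/
theorem eval_cons_one_zero_eq_coeff {K : Type*} [CommSemiring K] {m : ℕ}
    {G : MvPolynomial (Fin (m + 1)) K} {d : ℕ} (hG : G.IsHomogeneous d) :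
    eval (Fin.cons 1 0 : Fin (m + 1) → K) G = coeff (Finsupp.single 0 d) G := by
  classical
  rw [eval_eq']
  have hterm : ∀ e ∈ G.support, e ≠ Finsupp.single 0 d →
      coeff e G * ∏ j : Fin (m + 1), (Fin.cons 1 0 : Fin (m + 1) → K) j ^ e j = 0 := by
    intro e he hne
    have hdeg : e.degree = d := by
      by_contra h
      exact (mem_support_iff.mp he) (hG.coeff_eq_zero h)
    -- some `j ≠ 0` has `e j ≠ 0`
    obtain ⟨j, hj0, hj⟩ : ∃ j, j ≠ 0 ∧ e j ≠ 0 := by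
      by_contra hno
      push Not at hno
      apply hne
      have he0 : e = Finsupp.single 0 (e 0) := by
        ext j
        by_cases hj : j = 0
        · subst hj; rw [Finsupp.single_eq_same]
        · rw [Finsupp.single_eq_of_ne hj, hno j hj]
      rw [he0, Finsupp.degree_single] at hdeg
      rw [he0, hdeg]
    rw [Finset.prod_eq_zero (Finset.mem_univ j), mul_zero]
    obtain ⟨j', rfl⟩ := Fin.exists_succ_eq.mpr hj0
    rw [Fin.cons_succ, Pi.zero_apply, zero_pow hj]
  rw [Finset.sum_eq_single (Finsupp.single 0 d) hterm]
  · rw [Finset.prod_eq_one, mul_one]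
    intro j _
    by_cases hj : j = 0
    · subst hj; simp
    · rw [Finsupp.single_eq_of_ne hj, pow_zero]
  · intro hnot
    rw [notMem_support_iff.mp hnot, zero_mul]

/-- The coefficient of `τ^d` in `g(τ v + Σ σ_a p_a)` is `g(v)`. [folklore] -/
theorem coeff_single_zero_planeRestrict_cons {s : ℕ} (p : Fin (s + 1) → Fin (n + 1) → k)
    {g : MvPolynomial (Fin (n + 1)) k} {d : ℕ} (hg : g.IsHomogeneous d) (v : Fin (n + 1) → k) :
    coeff (Finsupp.single 0 d)
        (FanoPlanes.planeRestrict (Fin.cons v p : Fin (s + 2) → Fin (n + 1) → k) g) = eval v g := by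
  rw [← eval_cons_one_zero_eq_coeff (isHomogeneous_planeRestrict _ hg), eval_planeRestrict]
  have hsum : (∑ b : Fin (s + 2), (Fin.cons 1 0 : Fin (s + 2) → k) b •
      (Fin.cons v p : Fin (s + 2) → Fin (n + 1) → k) b) = v := by
    rw [Fin.sum_univ_succ]
    simp
  rw [hsum]
  rfl

/-- **Strong planes, coefficientwise (ELV Lemma 1.1, incidence `H`, general `s`).** Let `g` be a
form of degree `d` vanishing identically on the `s`-plane of `p`. If the coefficients of the universal
restriction `g(τ y + Σ σ_a p_a)` at all exponents of positive `τ`-degree OTHER than `τ^d` vanish at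
`v` ("the same equations, except the one for `(0, …, 0, d - 1)`"), then every coefficient of
`g(τ v + Σ σ_a p_a)` other than that of `τ^d` vanishes.
[cite: EsnaultLevineViehweg1997, Lemma 1.1 and its proof] -/
theorem coeff_planeRestrict_cons_eq_zero_of_ne {s : ℕ} (p : Fin (s + 1) → Fin (n + 1) → k)
    {g : MvPolynomial (Fin (n + 1)) k} {d : ℕ} (hg : g.IsHomogeneous d)
    (hgp : FanoPlanes.planeRestrict p g = 0) {v : Fin (n + 1) → k}
    (hv : ∀ β : Fin (s + 2) →₀ ℕ, β.degree + 1 = d → β ≠ Finsupp.single 0 (d - 1) →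
      eval v (coeff (β + Finsupp.single 0 1) (aeval (fun i : Fin (n + 1) =>
        (C (X i) * X 0 + ∑ a : Fin (s + 1), C (C (p a i)) * X a.succ :
          MvPolynomial (Fin (s + 2)) (MvPolynomial (Fin (n + 1)) k))) g)) = 0)
    {e : Fin (s + 2) →₀ ℕ} (he : e ≠ Finsupp.single 0 d) :
    coeff e (FanoPlanes.planeRestrict (Fin.cons v p : Fin (s + 2) → Fin (n + 1) → k) g) = 0 := by
  classical
  by_cases hdeg : e.degree = d
  · by_cases h0 : e 0 = 0
    · rw [← Finsupp.cons_tail e, h0, coeff_cons_zero_planeRestrict_cons, hgp, coeff_zero]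
    · have he' : e - Finsupp.single 0 1 + Finsupp.single 0 1 = e := sub_single_add_single h0
      have hβ : (e - Finsupp.single 0 1).degree + 1 = d := by
        have h := congr_arg Finsupp.degree he'
        rw [map_add, Finsupp.degree_single, hdeg] at h
        exact h
      have hne : e - Finsupp.single 0 1 ≠ Finsupp.single 0 (d - 1) := by
        intro h
        apply he
        rw [← he', h, ← Finsupp.single_add]
        congr 1
        omega
      rw [coeff_planeRestrict_cons_eq_eval, ← he']
      exact hv _ hβ hne
  · exact (isHomogeneous_planeRestrict _ hg).coeff_eq_zero hdeg

/-- **Strong planes (ELV Lemma 1.1, incidence `H`).** Under the hypotheses of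
`coeff_planeRestrict_cons_eq_zero_of_ne`: `g(τ v + Σ σ_a p_a) = g(v) · τ^d`, i.e. the `(s+1)`-plane
`H'` spanned by `v` and `H = ℙ(span p)` satisfies `H' ⊆ V₊(g)` (if `g(v) = 0`) or `H' ∩ V₊(g) = H`
set-theoretically, "the zero cycle of `f|_{H'}` is `H` with multiplicity `d`".
[cite: EsnaultLevineViehweg1997, Lemma 1.1] -/
theorem planeRestrict_cons_eq_C_mul_X_pow {s : ℕ} (p : Fin (s + 1) → Fin (n + 1) → k)
    {g : MvPolynomial (Fin (n + 1)) k} {d : ℕ} (hg : g.IsHomogeneous d)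
    (hgp : FanoPlanes.planeRestrict p g = 0) {v : Fin (n + 1) → k}
    (hv : ∀ β : Fin (s + 2) →₀ ℕ, β.degree + 1 = d → β ≠ Finsupp.single 0 (d - 1) →
      eval v (coeff (β + Finsupp.single 0 1) (aeval (fun i : Fin (n + 1) =>
        (C (X i) * X 0 + ∑ a : Fin (s + 1), C (C (p a i)) * X a.succ :
          MvPolynomial (Fin (s + 2)) (MvPolynomial (Fin (n + 1)) k))) g)) = 0) :
    FanoPlanes.planeRestrict (Fin.cons v p : Fin (s + 2) → Fin (n + 1) → k) g =
      C (eval v g) * X 0 ^ d := by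
  classical
  ext e
  rw [coeff_C_mul, coeff_X_pow]
  by_cases he : e = Finsupp.single 0 d
  · rw [he, coeff_single_zero_planeRestrict_cons p hg v, if_pos rfl, mul_one]
  · rw [coeff_planeRestrict_cons_eq_zero_of_ne p hg hgp hv he, if_neg (Ne.symm he), mul_zero]

/-- **On a strong plane, `V₊(g)` is the old plane**: if `g(τ v + Σ σ_a p_a) = g(v) · τ^d` with
`d ≥ 1` and `g(v) ≠ 0`, a vector `a v + Σ c_a p_a` of the `(s+1)`-plane lies on `V₊(g)` only if
`a = 0` (ELV's "`H' ∩ X = H`"). [cite: EsnaultLevineViehweg1997, Lemma 1.1] -/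
theorem eq_zero_of_aeval_eq_zero_of_planeRestrict_cons_eq {s : ℕ} (p : Fin (s + 1) → Fin (n + 1) → k)
    {g : MvPolynomial (Fin (n + 1)) k} {d : ℕ} (hd : 0 < d) {v : Fin (n + 1) → k}
    (hpv : FanoPlanes.planeRestrict (Fin.cons v p : Fin (s + 2) → Fin (n + 1) → k) g =
      C (eval v g) * X 0 ^ d)
    (hgv : eval v g ≠ 0) {a : k} {c : Fin (s + 1) → k}
    (hac : aeval (a • v + ∑ b, c b • p b) g = 0) : a = 0 := by
  have h := eval_planeRestrict (Fin.cons v p : Fin (s + 2) → Fin (n + 1) → k) g (Fin.cons a c)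
  rw [Fin.sum_univ_succ] at h
  simp only [Fin.cons_zero, Fin.cons_succ] at h
  rw [hac, hpv] at h
  simp only [map_mul, eval_C, map_pow, eval_X, Fin.cons_zero] at h
  have ha : a ^ d = 0 := (mul_eq_zero.mp h).resolve_left hgv
  exact pow_eq_zero_iff (Nat.pos_iff_ne_zero.mp hd) |>.mp ha

/-- **Existence of strong planes (ELV Lemma 1.1: "`π₁` is surjective if `C(s+d, s+1) ≤ n - s`";
Roitman's construction for `s = 0`).** Let `k` be algebraically closed, `F₁, …, F_r` forms of
degrees `dᵢ ≥ 1`, and `p₀, …, p_s` independent spanning an `s`-plane `H ⊆ V₊(F₁, …, F_r)`. If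
`Σᵢ (C(dᵢ + s, s + 1) - 1) ≤ n - s - 1`, there is `v`, independent from `p`, such that for every `i`
`Fᵢ(τ v + Σ σ_a p_a) = Fᵢ(v) · τ^{dᵢ}`: the `(s+1)`-plane `H' = ℙ(span(v, p))` is *strong* for every
`V₊(Fᵢ)` (`H' ⊆ V₊(Fᵢ)` or `H' ∩ V₊(Fᵢ) = H`).
[cite: EsnaultLevineViehweg1997, Lemma 1.1 and its proof] -/
theorem exists_planeRestrict_cons_eq_C_mul_X_pow [IsAlgClosed k] {ι : Type*} [Fintype ι]
    (F : ι → MvPolynomial (Fin (n + 1)) k) (d : ι → ℕ) (hF : ∀ i, (F i).IsHomogeneous (d i))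
    (hd : ∀ i, 0 < d i) {s : ℕ} {p : Fin (s + 1) → Fin (n + 1) → k} (hp : LinearIndependent k p)
    (hFp : ∀ i, FanoPlanes.planeRestrict p (F i) = 0)
    (hsum : ∑ i, (Nat.choose (d i + s) (s + 1) - 1) + s + 2 ≤ n + 1) :
    ∃ v : Fin (n + 1) → k, LinearIndependent k (Fin.cons v p : Fin (s + 2) → Fin (n + 1) → k) ∧
      ∀ i, FanoPlanes.planeRestrict (Fin.cons v p : Fin (s + 2) → Fin (n + 1) → k) (F i) =
        C (eval v (F i)) * X 0 ^ d i := by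
  classical
  obtain ⟨Lf, hLf0, hLf⟩ := exists_linearForms_dual hp
  let Φ : (Σ i : ι, Sym (Fin (s + 2)) (d i - 1)) → MvPolynomial (Fin (n + 1)) k := fun iβ =>
    coeff (Multiset.toFinsupp (iβ.2 : Multiset (Fin (s + 2))) + Finsupp.single 0 1)
      (aeval (fun j : Fin (n + 1) =>
        (C (X j) * X 0 + ∑ a : Fin (s + 1), C (C (p a j)) * X a.succ :
          MvPolynomial (Fin (s + 2)) (MvPolynomial (Fin (n + 1)) k))) (F iβ.1))
  -- the excluded exponent `τ^{d_i}` corresponds to `β = (d i - 1) • δ₀`, the multiset `replicate`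
  let βstar : (i : ι) → Sym (Fin (s + 2)) (d i - 1) := fun i =>
    ⟨Multiset.replicate (d i - 1) 0, Multiset.card_replicate _ _⟩
  let I : Finset (Σ i : ι, Sym (Fin (s + 2)) (d i - 1)) :=
    Finset.univ.filter fun iβ => iβ.2 ≠ βstar iβ.1
  let T : Finset (MvPolynomial (Fin (n + 1)) k) := Finset.univ.image Lf ∪ I.image Φ
  have h0 : ∀ q ∈ T, constantCoeff q = 0 := by
    intro q hq
    rcases Finset.mem_union.mp hq with hq | hq
    · obtain ⟨b, -, rfl⟩ := Finset.mem_image.mp hq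
      exact hLf0 b
    · obtain ⟨iβ, -, rfl⟩ := Finset.mem_image.mp hq
      exact constantCoeff_coeff_planeRestrictUniv p (hFp iβ.1) _
  have hcardSym : ∀ i, Fintype.card (Sym (Fin (s + 2)) (d i - 1)) = Nat.choose (d i + s) (s + 1) := by
    intro i
    rw [Sym.card_sym_eq_choose, Fintype.card_fin]
    have h1 : s + 2 + (d i - 1) - 1 = d i - 1 + (s + 1) := by have := hd i; omega
    have h2 : d i + s = d i - 1 + (s + 1) := by have := hd i; omega
    rw [h1, h2]
    exact Nat.choose_symm_add
  -- the complement of `I` is the image of `i ↦ ⟨i, βstar i⟩`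
  have hIc : (Finset.univ.filter fun iβ : (Σ i : ι, Sym (Fin (s + 2)) (d i - 1)) =>
      ¬ iβ.2 ≠ βstar iβ.1).card = Fintype.card ι := by
    have heq : (Finset.univ.filter fun iβ : (Σ i : ι, Sym (Fin (s + 2)) (d i - 1)) =>
        ¬ iβ.2 ≠ βstar iβ.1) = Finset.univ.image fun i => (⟨i, βstar i⟩ : Σ i, Sym _ (d i - 1)) := by
      ext iβ
      simp only [ne_eq, not_not, Finset.mem_filter, Finset.mem_univ, true_and, Finset.mem_image]
      constructor
      · intro h
        exact ⟨iβ.1, by rw [← h]⟩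
      · rintro ⟨i, rfl⟩
        rfl
    rw [heq, Finset.card_image_of_injective _ fun i j hij => congr_arg Sigma.fst hij,
      Finset.card_univ]
  have hIcard : I.card + Fintype.card ι = ∑ i, Nat.choose (d i + s) (s + 1) := by
    rw [← hIc, Finset.card_filter_add_card_filter_not, Finset.card_univ,
      Fintype.card_sigma]
    simp_rw [hcardSym]
  have hchoose1 : ∀ i, 1 ≤ Nat.choose (d i + s) (s + 1) := fun i =>
    Nat.choose_pos (by have := hd i; omega)
  have hsub : ∑ i, (Nat.choose (d i + s) (s + 1) - 1) + Fintype.card ι =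
      ∑ i, Nat.choose (d i + s) (s + 1) := by
    rw [← Finset.card_univ, Finset.card_eq_sum_ones, ← Finset.sum_add_distrib]
    exact Finset.sum_congr rfl fun i _ => Nat.sub_add_cancel (hchoose1 i)
  have hcard : T.card < n + 1 := by
    calc T.card ≤ (Finset.univ.image Lf).card + (I.image Φ).card := Finset.card_union_le _ _
      _ ≤ Fintype.card (Fin (s + 1)) + I.card := by
          gcongr
          · exact Finset.card_image_le.trans Finset.card_univ.le
          · exact Finset.card_image_le
      _ = (s + 1) + I.card := by rw [Fintype.card_fin]
      _ < n + 1 := by omega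
  obtain ⟨v, hv0, hv⟩ :=
    Literature.RingTheory.KrullDimension.exists_ne_zero_common_zero_of_card_lt T h0 hcard
  refine ⟨v, ?_, fun i => ?_⟩
  · rw [linearIndependent_finCons]
    refine ⟨hp, fun hmem => hv0 ?_⟩
    obtain ⟨c, hc⟩ := (_root_.Submodule.mem_span_range_iff_exists_fun k).mp hmem
    have hc0 : ∀ b, c b = 0 := by
      intro b
      rw [← hLf c b, hc]
      exact hv (Lf b) (Finset.mem_union_left _ (Finset.mem_image_of_mem Lf (Finset.mem_univ b)))
    rw [← hc]
    exact Finset.sum_eq_zero fun a _ => by rw [hc0 a, zero_smul]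
  · refine planeRestrict_cons_eq_C_mul_X_pow p (hF i) (hFp i) fun β hβ hne => ?_
    let βs : Sym (Fin (s + 2)) (d i - 1) := ⟨Finsupp.toMultiset β, by
      rw [Finsupp.card_toMultiset]
      change β.degree = d i - 1
      omega⟩
    have hβs : βs ≠ βstar i := by
      intro h
      apply hne
      have h' : Finsupp.toMultiset β = Multiset.replicate (d i - 1) 0 := congr_arg Subtype.val h
      rw [← Finsupp.toMultiset_toFinsupp β, h', ← Multiset.nsmul_singleton,
        ← Finsupp.toMultiset_single, Finsupp.toMultiset_toFinsupp]
    have hmemI : (⟨i, βs⟩ : Σ i, Sym (Fin (s + 2)) (d i - 1)) ∈ I :=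
      Finset.mem_filter.mpr ⟨Finset.mem_univ _, hβs⟩
    have hmem : Φ ⟨i, βs⟩ ∈ T := Finset.mem_union_right _ (Finset.mem_image_of_mem Φ hmemI)
    have h := hv _ hmem
    simp only [Φ, βs, Sym.coe_mk, Finsupp.toMultiset_toFinsupp] at h
    exact h

end StrongPlanes

end EsnaultLevineViehweg

section RankLeOne

/-- **Rank `≤ 1` from generators.** In an abelian group generated by a set `S` any two of whose
members are `ℤ`-dependent, any two elements are `ℤ`-dependent: either every generator is torsion
(then the group is torsion), or some generator `g` has infinite order, every generator — hence
every element — has a non-zero multiple in `ℤ g`, and two such elements are dependent. (The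
`ℚ`-rank-`≤ 1` bookkeeping behind "CH_l(X_v)_ℚ = ℚ": ELV, proof of Thm. 4.6, last paragraph.)
[folklore] -/
theorem exists_smul_eq_smul_of_closure_eq_top {A : Type*} [AddCommGroup A] (S : Set A)
    (hS : AddSubgroup.closure S = ⊤)
    (h : ∀ a ∈ S, ∀ b ∈ S, ∃ p q : ℤ, (p ≠ 0 ∨ q ≠ 0) ∧ p • a = q • b) (x y : A) :
    ∃ p q : ℤ, (p ≠ 0 ∨ q ≠ 0) ∧ p • x = q • y := by
  classical
  by_cases htor : ∀ a ∈ S, ∃ N : ℤ, N ≠ 0 ∧ N • a = 0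
  · -- every generator, hence every element, is torsion
    have key : ∀ z : A, ∃ N : ℤ, N ≠ 0 ∧ N • z = 0 := by
      intro z
      have hz : z ∈ AddSubgroup.closure S := by rw [hS]; trivial
      induction hz using AddSubgroup.closure_induction with
      | mem a ha => exact htor a ha
      | zero => exact ⟨1, one_ne_zero, smul_zero _⟩
      | add a b _ _ iha ihb =>
        obtain ⟨N, hN, hNa⟩ := iha
        obtain ⟨M, hM, hMb⟩ := ihb
        refine ⟨M * N, mul_ne_zero hM hN, ?_⟩
        rw [smul_add, mul_smul, hNa, smul_zero, zero_add, mul_comm, mul_smul, hMb, smul_zero]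
      | neg a _ iha =>
        obtain ⟨N, hN, hNa⟩ := iha
        exact ⟨N, hN, by rw [smul_neg, hNa, neg_zero]⟩
    obtain ⟨N, hN, hNx⟩ := key x
    exact ⟨N, 0, Or.inl hN, by rw [hNx, zero_smul]⟩
  · push Not at htor
    obtain ⟨g, hgS, hg⟩ := htor
    -- every element has a non-zero multiple in `ℤ g`
    have key : ∀ z : A, ∃ N m : ℤ, N ≠ 0 ∧ N • z = m • g := by
      intro z
      have hz : z ∈ AddSubgroup.closure S := by rw [hS]; trivial
      induction hz using AddSubgroup.closure_induction with
      | mem a ha =>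
        obtain ⟨p, q, hpq, hab⟩ := h a ha g hgS
        by_cases hp : p = 0
        · exfalso
          have hq : q ≠ 0 := hpq.resolve_left (not_not.mpr hp)
          apply hg q hq
          rw [← hab, hp, zero_smul]
        · exact ⟨p, q, hp, hab⟩
      | zero => exact ⟨1, 0, one_ne_zero, by rw [smul_zero, zero_smul]⟩
      | add a b _ _ iha ihb =>
        obtain ⟨N, m, hN, hNa⟩ := iha
        obtain ⟨M, m', hM, hMb⟩ := ihb
        refine ⟨M * N, M * m + N * m', mul_ne_zero hM hN, ?_⟩
        rw [smul_add, mul_smul, hNa, mul_comm M N, mul_smul, hMb, add_smul, mul_smul, mul_smul,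
          smul_comm M m g, smul_comm N m' g]
      | neg a _ iha =>
        obtain ⟨N, m, hN, hNa⟩ := iha
        exact ⟨N, -m, hN, by rw [smul_neg, hNa, neg_smul]⟩
    obtain ⟨N₁, m₁, hN₁, hx⟩ := key x
    obtain ⟨N₂, m₂, hN₂, hy⟩ := key y
    by_cases hm : m₁ = 0
    · refine ⟨N₁, 0, Or.inl hN₁, ?_⟩
      rw [hx, hm, zero_smul, zero_smul]
    · refine ⟨m₂ * N₁, m₁ * N₂, Or.inr (mul_ne_zero hm hN₂), ?_⟩
      rw [mul_smul, hx, mul_smul, hy, smul_comm]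

open Order in
/-- **`CH_d` of `ℚ`-rank `≤ 1` from subvarieties** (compact `Y`): if the classes
`[closure {z}], [closure {z'}] ∈ CH_d(Y)` of any two `d`-dimensional points are `ℤ`-dependent, then
any two classes in `CH_d(Y)` are `ℤ`-dependent — `CH_d(Y)` is generated by the classes of
`d`-dimensional subvarieties (Fulton §1.3; `ChowGroup.eq_top_of_forall_ofPoint_mem`). This is the
form in which "`CH_s(X_v)_ℚ = ℚ`, with generator a linear space" (ELV Thm. 4.6) feeds the rank-`≤ 1`
rendering of the named fact. [cite: EsnaultLevineViehweg1997, proof of Thm. 4.6 (last paragraph)] -/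
theorem chowGroup_exists_smul_eq_smul_of_forall_ofPoint {Y : Scheme.{u}} [CompactSpace Y] {d : ℕ}
    (h : ∀ (z z' : Y) (hz : height z = d) (hz' : height z' = d),
      ∃ p q : ℤ, (p ≠ 0 ∨ q ≠ 0) ∧ p • ChowGroup.ofPoint z hz = q • ChowGroup.ofPoint z' hz')
    (x y : ChowGroup Y d) : ∃ p q : ℤ, (p ≠ 0 ∨ q ≠ 0) ∧ p • x = q • y := by
  refine exists_smul_eq_smul_of_closure_eq_top
    {c : ChowGroup Y d | ∃ (z : Y) (hz : height z = d), c = ChowGroup.ofPoint z hz} ?_ ?_ x y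
  · exact ChowGroup.eq_top_of_forall_ofPoint_mem fun z hz => AddSubgroup.subset_closure ⟨z, hz, rfl⟩
  · rintro a ⟨z, hz, rfl⟩ b ⟨z', hz', rfl⟩
    exact h z z' hz hz'

open Order in
/-- **`CH_d` of `ℚ`-rank `≤ 1` from subvarieties, for a smooth projective variety** (compact by
`IsSmoothProjective.compactSpace_holds`): the conclusion of
`EsnaultLevineViehweg1997_chowGroup_rank_le_one` for `CH_{l'}(X)` follows once any two
`l'`-dimensional closed subvarieties of `X` have `ℤ`-dependent classes.
[cite: EsnaultLevineViehweg1997, proof of Thm. 4.6 (last paragraph)] -/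
theorem chowGroup_exists_smul_eq_smul_of_isSmoothProjective {k : Type u} [Field k] {m : ℕ}
    {X : SchemeOver k} (hX : IsSmoothProjective m X) {d : ℕ}
    (h : ∀ (z z' : ↥X.left) (hz : height z = d) (hz' : height z' = d),
      ∃ p q : ℤ, (p ≠ 0 ∨ q ≠ 0) ∧ p • ChowGroup.ofPoint z hz = q • ChowGroup.ofPoint z' hz')
    (x y : ChowGroup X.left d) : ∃ p q : ℤ, (p ≠ 0 ∨ q ≠ 0) ∧ p • x = q • y := by
  haveI : CompactSpace ↥X.left := IsSmoothProjective.compactSpace_holds hX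
  exact chowGroup_exists_smul_eq_smul_of_forall_ofPoint h x y

/-- **Rank `≤ 1` from generators up to multiples.** In an abelian group `A`, let `S` be a set any
two of whose members are `ℤ`-dependent, and suppose every element of `A` has a NON-ZERO multiple in
the subgroup generated by `S`. Then any two elements of `A` are `ℤ`-dependent. [folklore] -/
theorem exists_smul_eq_smul_of_forall_exists_smul_mem_closure {A : Type*} [AddCommGroup A]
    (S : Set A) (hgen : ∀ x : A, ∃ N : ℤ, N ≠ 0 ∧ N • x ∈ AddSubgroup.closure S)
    (h : ∀ a ∈ S, ∀ b ∈ S, ∃ p q : ℤ, (p ≠ 0 ∨ q ≠ 0) ∧ p • a = q • b) (x y : A) :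
    ∃ p q : ℤ, (p ≠ 0 ∨ q ≠ 0) ∧ p • x = q • y := by
  classical
  by_cases htor : ∀ a ∈ S, ∃ N : ℤ, N ≠ 0 ∧ N • a = 0
  · -- every generator, hence every element of the closure, is torsion
    have key : ∀ z ∈ AddSubgroup.closure S, ∃ N : ℤ, N ≠ 0 ∧ N • z = 0 := by
      intro z hz
      induction hz using AddSubgroup.closure_induction with
      | mem a ha => exact htor a ha
      | zero => exact ⟨1, one_ne_zero, smul_zero _⟩
      | add a b _ _ iha ihb =>
        obtain ⟨N, hN, hNa⟩ := iha
        obtain ⟨M, hM, hMb⟩ := ihb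
        refine ⟨M * N, mul_ne_zero hM hN, ?_⟩
        rw [smul_add, mul_smul, hNa, smul_zero, zero_add, mul_comm, mul_smul, hMb, smul_zero]
      | neg a _ iha =>
        obtain ⟨N, hN, hNa⟩ := iha
        exact ⟨N, hN, by rw [smul_neg, hNa, neg_zero]⟩
    obtain ⟨N₀, hN₀, hx⟩ := hgen x
    obtain ⟨N, hN, hNx⟩ := key _ hx
    refine ⟨N * N₀, 0, Or.inl (mul_ne_zero hN hN₀), ?_⟩
    rw [mul_smul, hNx, zero_smul]
  · push Not at htor
    obtain ⟨g, hgS, hg⟩ := htor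
    have key : ∀ z ∈ AddSubgroup.closure S, ∃ N m : ℤ, N ≠ 0 ∧ N • z = m • g := by
      intro z hz
      induction hz using AddSubgroup.closure_induction with
      | mem a ha =>
        obtain ⟨p, q, hpq, hab⟩ := h a ha g hgS
        by_cases hp : p = 0
        · exfalso
          have hq : q ≠ 0 := hpq.resolve_left (not_not.mpr hp)
          apply hg q hq
          rw [← hab, hp, zero_smul]
        · exact ⟨p, q, hp, hab⟩
      | zero => exact ⟨1, 0, one_ne_zero, by rw [smul_zero, zero_smul]⟩
      | add a b _ _ iha ihb =>
        obtain ⟨N, m, hN, hNa⟩ := iha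
        obtain ⟨M, m', hM, hMb⟩ := ihb
        refine ⟨M * N, M * m + N * m', mul_ne_zero hM hN, ?_⟩
        rw [smul_add, mul_smul, hNa, mul_comm M N, mul_smul, hMb, add_smul, mul_smul, mul_smul,
          smul_comm M m g, smul_comm N m' g]
      | neg a _ iha =>
        obtain ⟨N, m, hN, hNa⟩ := iha
        exact ⟨N, -m, hN, by rw [smul_neg, hNa, neg_smul]⟩
    obtain ⟨Nx, hNx, hx⟩ := hgen x
    obtain ⟨Ny, hNy, hy⟩ := hgen y
    obtain ⟨N₁, m₁, hN₁, hx₁⟩ := key _ hx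
    obtain ⟨N₂, m₂, hN₂, hy₂⟩ := key _ hy
    rw [← mul_smul] at hx₁ hy₂
    by_cases hm : m₁ = 0
    · refine ⟨N₁ * Nx, 0, Or.inl (mul_ne_zero hN₁ hNx), ?_⟩
      rw [hx₁, hm, zero_smul, zero_smul]
    · refine ⟨m₂ * (N₁ * Nx), m₁ * (N₂ * Ny), Or.inr (mul_ne_zero hm (mul_ne_zero hN₂ hNy)), ?_⟩
      rw [mul_smul, hx₁, mul_smul, hy₂, smul_comm]

open Order in
/-- Integral combinations of prime cycles of `d`-dimensional points are `d`-cycles. [folklore] -/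
theorem sum_zsmul_primeCycle_mem_cyclesOfDim_of_height {Y : Scheme.{u}} {d : ℕ} {s : Finset Y}
    (w : Y → ℤ) (hs : ∀ y ∈ s, height y = d) :
    (∑ y ∈ s, w y • primeCycle y) ∈ cyclesOfDim Y d :=
  AddSubgroup.sum_mem _ fun y hy => AddSubgroup.zsmul_mem _ (primeCycle_mem_cyclesOfDim (hs y hy)) _

open Order in
/-- **Skeleton of the proof of ELV Thm. 4.6 (Chow level, on a compact scheme).** Let `P` be a
property of `d`-dimensional points of `Y` ("is an `l`-plane of `X_v`"). Suppose
(a) *generation up to multiples* — every prime `d`-cycle `[closure {z}]` has a non-zero multiple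
rationally equivalent to an integral combination of prime cycles of `P`-points (ELV §3,
Prop. 3.1 with Addendum 3.2, iterated over `σ`, and `CH_{t+l}(ℙⁿ) = ℤ`: "`CH_l(X_v)_ℚ` is generated
by the classes of `l`-planes contained in `X_v`"), and
(b) *equality up to multiples* — the prime cycles of any two `P`-points have `ℤ`-dependent classes
(ELV Prop. 4.4: "`A₀(Gr_k(l; X_v))_ℚ = 0`, hence all the `l`-planes in `X_v` have the same class in
`CH_l(X_v)_ℚ`").
Then any two classes in `CH_d(Y)` are `ℤ`-dependent — the conclusion of the named fact
`EsnaultLevineViehweg1997_chowGroup_rank_le_one` for `CH_d`. (Pure cycle algebra over Fulton §1.3: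
`CH_d` of a compact scheme is generated by prime cycles.)
[cite: EsnaultLevineViehweg1997, Thm. 4.6 (structure of the proof)] -/
theorem chowGroup_exists_smul_eq_smul_of_inputs {Y : Scheme.{u}} [CompactSpace Y] {d : ℕ}
    (P : Y → Prop) (hP : ∀ y, P y → height y = d)
    (hgen : ∀ z : Y, height z = d → ∃ N : ℤ, N ≠ 0 ∧ ∃ (s : Finset Y) (w : Y → ℤ),
      (∀ y ∈ s, P y) ∧ IsRationallyEquivalent (N • primeCycle z) (∑ y ∈ s, w y • primeCycle y) d)
    (heq : ∀ (y y' : Y) (hy : P y) (hy' : P y'), ∃ p q : ℤ, (p ≠ 0 ∨ q ≠ 0) ∧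
      p • ChowGroup.ofPoint y (hP y hy) = q • ChowGroup.ofPoint y' (hP y' hy'))
    (a b : ChowGroup Y d) : ∃ p q : ℤ, (p ≠ 0 ∨ q ≠ 0) ∧ p • a = q • b := by
  classical
  -- `S` = classes of `P`-points; `T` = its closure
  let S : Set (ChowGroup Y d) := {c | ∃ (y : Y) (hy : P y), c = ChowGroup.ofPoint y (hP y hy)}
  refine exists_smul_eq_smul_of_forall_exists_smul_mem_closure S ?_ ?_ a b
  · -- every class has a non-zero multiple in the closure: reduce to prime cycles
    intro x
    -- the set of such `x` is a subgroup containing all point classes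
    let H : AddSubgroup (ChowGroup Y d) :=
      { carrier := {x | ∃ N : ℤ, N ≠ 0 ∧ N • x ∈ AddSubgroup.closure S}
        zero_mem' := ⟨1, one_ne_zero, by rw [smul_zero]; exact AddSubgroup.zero_mem _⟩
        add_mem' := by
          rintro x y ⟨N, hN, hx⟩ ⟨M, hM, hy⟩
          refine ⟨M * N, mul_ne_zero hM hN, ?_⟩
          rw [smul_add, mul_smul, mul_comm, mul_smul]
          exact AddSubgroup.add_mem _ (AddSubgroup.zsmul_mem _ hx _) (AddSubgroup.zsmul_mem _ hy _)
        neg_mem' := by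
          rintro x ⟨N, hN, hx⟩
          exact ⟨N, hN, by rw [smul_neg]; exact AddSubgroup.neg_mem _ hx⟩ }
    have hH : H = ⊤ := by
      refine ChowGroup.eq_top_of_forall_ofPoint_mem fun z hz => ?_
      obtain ⟨N, hN, s, w, hs, hrat⟩ := hgen z hz
      refine ⟨N, hN, ?_⟩
      have hmem : (∑ y ∈ s, w y • primeCycle y) ∈ cyclesOfDim Y d :=
        sum_zsmul_primeCycle_mem_cyclesOfDim_of_height w fun y hy => hP y (hs y hy)
      have h1 : N • ChowGroup.ofPoint z hz = ChowGroup.mk Y d ⟨∑ y ∈ s, w y • primeCycle y, hmem⟩ := by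
        rw [ChowGroup.ofPoint, ← map_zsmul, ChowGroup.mk_eq_mk_iff]
        exact hrat
      have h2 : (⟨∑ y ∈ s, w y • primeCycle y, hmem⟩ : ↥(cyclesOfDim Y d)) =
          ∑ y ∈ s.attach, w y • ⟨primeCycle (y : Y),
            primeCycle_mem_cyclesOfDim (hP y (hs y y.2))⟩ := by
        apply Subtype.ext
        rw [AddSubgroup.val_finsetSum]
        simp only [AddSubgroup.coe_zsmul]
        exact (Finset.sum_attach s (fun y => w y • primeCycle y)).symm
      rw [h1, h2, map_sum]
      refine AddSubgroup.sum_mem _ fun y _ => ?_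
      rw [map_zsmul]
      exact AddSubgroup.zsmul_mem _
        (AddSubgroup.subset_closure (k := S) ⟨(y : Y), hs y y.2, rfl⟩) _
    have hx : x ∈ H := by rw [hH]; trivial
    exact hx
  · rintro _ ⟨y, hy, rfl⟩ _ ⟨y', hy', rfl⟩
    exact heq y y' hy hy'

open Order in
/-- **"A weakly rationally connected `Y` has `A₀(Y)_ℚ = 0`" (ELV §4, p. 15), Chow-level skeleton.**
Let `R` be a relation on the points of a compact scheme `Y` ("`z` and `z'` lie on a common rational
curve — e.g. a line — of `Y`") such that (i) `R`-related points are `0`-dimensional with POSITIVELY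
proportional classes, `N • [z] = M • [z']`, `N, M > 0` (two points of a rational curve: both are
positive multiples of the class of a degree-one divisor of the curve), and (ii) any two
`0`-dimensional points are joined by a finite `R`-chain (weak rational connectedness; for the lines
on a smooth complete intersection of index `≥ 2` this is the rational chain connectedness input,
Kollár–Miyaoka–Mori / Campana, of ELV Prop. 4.4 with `Gr(0; X) = X`). Then any two classes in
`CH₀(Y)` are `ℤ`-dependent — the conclusion of the named fact for `l' = 0`, e.g. the shape of
`Summit.HodgeConjecture.….SchlafliMinusFive.ChowZeroTrivial23`. Positivity in (i) is what makes
chains compose. [cite: EsnaultLevineViehweg1997, §4 (p. 15: weakly rationally connected ⇒ A₀ = 0) and Prop. 4.4] -/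
theorem chowGroup_zero_exists_smul_eq_smul_of_reflTransGen {Y : Scheme.{u}} [CompactSpace Y]
    (R : Y → Y → Prop)
    (hR : ∀ z z', R z z' → ∃ (hz : height z = 0) (hz' : height z' = 0) (N M : ℕ), 0 < N ∧ 0 < M ∧
      N • ChowGroup.ofPoint z (by exact_mod_cast hz) = M • ChowGroup.ofPoint z' (by exact_mod_cast hz'))
    (hchain : ∀ z z' : Y, height z = 0 → height z' = 0 → Relation.ReflTransGen R z z')
    (a b : ChowGroup Y 0) : ∃ p q : ℤ, (p ≠ 0 ∨ q ≠ 0) ∧ p • a = q • b := by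
  classical
  -- positive proportionality propagates along `R`-chains
  have key : ∀ (z z' : Y) (hz : height z = 0), Relation.ReflTransGen R z z' →
      ∃ (hz' : height z' = 0) (N M : ℕ), 0 < N ∧ 0 < M ∧
        N • ChowGroup.ofPoint z (by exact_mod_cast hz) =
          M • ChowGroup.ofPoint z' (by exact_mod_cast hz') := by
    intro z z' hz h
    induction h with
    | refl => exact ⟨hz, 1, 1, one_pos, one_pos, rfl⟩
    | tail _ hw ih =>
      obtain ⟨hw0, N, M, hN, hM, hNM⟩ := ih
      obtain ⟨hw0', hz'0, N', M', hN', hM', hNM'⟩ := hR _ _ hw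
      refine ⟨hz'0, N' * N, M * M', Nat.mul_pos hN' hN, Nat.mul_pos hM hM', ?_⟩
      rw [mul_smul, hNM, smul_comm, hNM', ← mul_smul]
  refine chowGroup_exists_smul_eq_smul_of_forall_ofPoint (fun z z' hz hz' => ?_) a b
  have hz0 : height z = 0 := by exact_mod_cast hz
  have hz'0 : height z' = 0 := by exact_mod_cast hz'
  obtain ⟨hz'1, N, M, hN, hM, hNM⟩ := key z z' hz0 (hchain z z' hz0 hz'0)
  refine ⟨N, M, Or.inl (by exact_mod_cast hN.ne'), ?_⟩
  rw [natCast_zsmul, natCast_zsmul]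
  exact hNM

end RankLeOne


end Literature.AlgebraicGeometry.Motives

end
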